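import Literature.Barriers.RiemannHypothesis.SemilocalCutoffInnerCriterion
import Literature.NumberTheory.ConnesConsani.AdeleClassTraceFormula
import Literature.NumberTheory.LFunctions.WeilSemilocalNegative
import Literature.NumberTheory.LFunctions.WeilSemilocalEventuallyNegative
import Literature.NumberTheory.LFunctions.RiemannSiegelThetaBounds
import Literature.NumberTheory.LFunctions.RiemannSiegelPhase
import Literature.NumberTheory.Automorphic.MeyerThetaMellin
import Mathlib.Analysis.CStarAlgebra.ContinuousLinearMap
import Mathlib.Analysis.Fourier.FourierTransform
import Mathlib.Analysis.Fourier.PoissonSummation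
import Mathlib.Analysis.InnerProductSpace.Positive
import Mathlib.Analysis.InnerProductSpace.StarOrder
import Mathlib.Analysis.SpecialFunctions.Gamma.Deligne
import Mathlib.Analysis.SpecialFunctions.Gaussian.GaussianIntegral
import Mathlib.NumberTheory.LSeries.RiemannZeta
import Mathlib.NumberTheory.LSeries.DirichletContinuation
import Mathlib.Data.Nat.Squarefree
import HarnessLib

/-!
# Connes–Consani, *The scaling Hamiltonian* (J. Operator Theory 85 (2021)) — §§2–4 as printed

RH-FREE corpus literature (cell rh-crit, C1 Connes–Consani, overflow row O3; bears_on W-C/W-P, sequel — no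
leaf role).  Nothing in this file is, or is worded as, progress toward RH: it types the operator-theoretic
objects of the paper and PROVES its elementary printed claims; the one RH-related sentence of the source
(Conjecture 4.1) is a CONJECTURE and is deliberately NOT vendored (conjectures are not Literature).

Source: A. Connes, C. Consani, *The scaling Hamiltonian*, J. Operator Theory 85 (2021) 259–278 =
arXiv:1910.14368 [bib `ConnesConsani2021ScalingHamiltonian`]; read from the arXiv TeX (`lit read
arxiv:1910.14368`, 11 chunks; locators `§ / statement / chunk pNNNN:Lnn`).  Statement numbers (Def. 2.1 …
Remark 4.2) are those printed in the paper; equation numbers `(k.n)` are counted section-wise from the numbered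
display environments of the arXiv TeX (the chunk locator `pNNNN:Lnn` is the authoritative pointer).

## Source item → tree declaration (this file unless a path is given) → status

| § | printed item (locator) | declaration | status |
|---|---|---|---|
| §2.1 | Def. 2.1 `đf := [H, f]`, `H = 2P − 1` (p0005:L55; eqs. (2.1), (2.7)) | `Literature.Barriers.RiemannHypothesis.cutoffSign`, `….quantizedDiff` (file `Literature/Barriers/RiemannHypothesis/SemilocalCutoffInnerCriterion.lean`) | CITED (in tree); here: `cutoffSign_mul_self` (`F² = 1`), PROVED |
| §2.1 | graded differential `đω := Fω − (−1)ⁿ ωF` (2.2), `đ² = 0` (p0005:L25–L29) | `gradedQDiff`, `gradedQDiff_succ_gradedQDiff`, `quantizedDiff_eq_gradedQDiff` | PROVED |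
| §2.1 | kernel `k(s,t) = (i/π)(f(s) − f(t))/(s − t)` of `đf` for the Hilbert transform ((2.6), (2.8), p0005:L49–L64) | `hilbertKernel`, `quantizedDiffKernel`, `hilbertKernel_commutator` | DEFINED + kernel identity PROVED (pointwise; the singular-integral operator itself is not built — no Hilbert transform in Mathlib) |
| §2.1 | modulated groups `C`, `H = 2 F_C 1_P F_C⁻¹ − 1`, `Π_{[a,b]}` ((2.9)–(2.11), p0005:L65–L89) | — | NOT typed (needs `L²` of a general LCA dual; cite only) |
| §2.2 | `A_S`, `ℤ_S` (2.13), `ℤ_S^* = {± p₁^{n₁}⋯p_k^{n_k}}` (2.14) = (1.1), `X_S = A_S/ℤ_S^*` (2.15), `C_{ℚ,S}` (2.16), `ϑ(λ)` (2.17)–(2.18) | `unitsZS` (2.14) with `mem_unitsZS_iff`, `neg_one_mem_unitsZS`, `prime_mem_unitsZS_iff`; for `S = {p, q, ∞}` the tree's `Literature.NumberTheory.ConnesConsani2024.Gamma`, `SemilocalAdeles`, `SemilocalClassSpace` (KnotsPrimesSemilocal.lean) | (2.14) DEFINED; `L²(X_S)`, `ϑ`, `w` NOT typed (no `L²(X_S)`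 in the tree; the general `X_S` notations belong to the CCM 2024 §4.1 file of this cell) |
| §2.2 | Lemma 2.2 (`𝔽_α` unitary on `L²(X_S)`, p0005:L135), `u = ∏ u_v ∘ π_v` (2.21), Lemma 2.3 (`𝔽_α = w⁻¹ I 𝔽_C⁻¹ u 𝔽_C w`, p0006:L31) | — | NOT typed (operator statements on `L²(X_S)`; [CMbook] Prop. 2.30 / Lemma 2.3 cited) |
| §2.3 | cutoffs `P_Λ`, `P̂_Λ`, `R_Λ = P̂_Λ P_Λ` (2.23)–(2.24), Lemma 2.4 (`W_Λ`, p0006:L67), (2.26)–(2.27) | — | NOT typed (same reason) |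
| §2.3 | **Theorem 2.5** semi-local trace formula `Tr(ϑ(f)R_Λ) = 2f(1) log Λ + Σ_{v∈S} ∫'_{ℚ_v^*} f(w⁻¹)/|1−w| d*w + o(1)` (p0006:L98; = [Co-zeta] Thm VII.4 = [CMbook] Ch. 2) | RIGHT-HAND SIDE = `Literature.NumberTheory.ConnesConsani.connesSemilocalGeometricSide` (AdeleClassTraceFormula.lean, with `connesLocalTerm`, `connesArchPV`); the theorem itself is the cell's O1 named fact (Connes 1999 Thm VII.4) | CITED, not restated here |
| §2.3 | symmetric form (2.29): `h(λ) = |λ|^{1/2} f(λ)`, `∫' f(w⁻¹)/|1−w| d*w = ∫' |w|^{1/2}/|1−w| h(w) d*w` | dictionary: the paper's `h(w) = g(log|w|)` for the tree's additive test function `g`, and `∫'_{ℝ^*} = connesArchPV g` (docstring of `SemilocalTraceInequality`) | dictionary only |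
| §3 | Fact 3.1 `A, B ≥ 0` bounded, `AB` trace class `⇒ Tr(AB) ≥ 0` (p0007:L8) | `trace_mul_nonneg_of_nonneg` (finite-dimensional Hilbert space; `-- TODO(general form)` trace class); matrices: `Literature.LinearAlgebra.Matrix.NearestPositiveSemidefinite.trace_mul_nonneg` | PROVED (finite-dimensional case; Mathlib has no trace class) |
| §3 | Fact 3.2 the explicit formula for compactly supported `h` involves finitely many places (p0007:L16) | tree: `Literature.NumberTheory.LFunctions.weilSemilocalQuadratic_eq_weilQuadratic_of_forall`, `weilSemilocalPrimeTerm_eq_sum_of_tsupport_subset` (WeilSemilocalQuadratic.lean) | CITED (in tree) |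
| §3 | inequality (3.1) `Σ_{v∈S} ∫' |w|^{1/2}/|1−w| h(w) d*w ≤ 0`, `h = h₁ * h₁^*` (p0007:L21) | `SemilocalTraceInequality P` (`S = {∞} ∪ P`) | DEFINED |
| §3 | Fact 3.3 `ĥ₁ ĥ₂ ≥ 0` for `h₂ = h₁^*` (p0007:L29) | `mul_star_self_nonneg'` (abstract form `A A* ≥ 0`) | PROVED (Mathlib `mul_star_self_nonneg`) |
| §3 | (3.2) `Σ_v ∫' … = Tr(ĥ₁ĥ₂(½u⁻¹đu))`; `T = P P̂ P = P u*(1−P) u P` (p0007:L31–L42) | the operator `P u*(1−P) u P` is the left side of `Literature.Barriers.RiemannHypothesis.innerCriterion_tfae` (i) | trace identity NOT typed; `T` cited |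
| §3 | **Lemma 3.4** TFAE (i) `Pu*(1−P)uP = −½u⁻¹đu` (ii) `u⁻¹đu ≤ 0` (iii) `Pu = PuP` (p0007:L46) | `Literature.Barriers.RiemannHypothesis.innerCriterion_tfae` (+ the three implications) | CITED — PROVED in tree |
| §3 | **Corollary 3.5** conditions hold iff `u*` is inner in Beurling's sense (p0007:L66; proof p0008:L1: iff `u*` preserves `range P`) | `invariant_iff_range_stable_under_star` (abstract: (iii) ⟺ `u*(range P) ⊆ range P`) | PROVED (abstract form; the Hardy-space reading `P = Π_{[0,∞]}` is the definition of "inner" used in print, see docstring) |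
| §3 | (3.3) `u_p(s) = (1 − p^{−(1−z)})/(1 − p^{−z})`, `z = ½ + is`; modulus `1` on the line; poles `z ∈ 2πiℤ/log p`; holomorphic on the right half-plane; unbounded, `∼ −p^{z−1}` (p0008:L5–L15) | `localFactorRatio`, `norm_localFactorRatio_half_add`, `one_sub_cpow_neg_eq_zero_iff`, `differentiableOn_localFactorRatio`, `localFactorRatio_ofReal`, `tendsto_localFactorRatio_div`, `tendsto_norm_localFactorRatio_atTop`, `not_bddAbove_norm_localFactorRatio` | PROVED |
| §3 | (3.4) `u_∞(s) = φ(½+is)`, `φ(z) = π^{(1−z)/2−z/2} Γ(z/2)/Γ((1−z)/2)`; modulus `1` on the line; complement-formula form `φ(z) = π^{−½−z} Γ(z/2)Γ((1+z)/2) sin(π(1+z)/2)`; vanishes at odd integers; `φ(20) = 1856156927625/(8π^{20}) ≃ 26.4562` (p0008:L16–L31) | `archLocalRatio` (`= Complex.Gammaℝ z / Complex.Gammaℝ (1 − z)`), `archLocalRatio_eq_printed`, `norm_archLocalRatio_half_add`, `archLocalRatio_eq_sin`, `archLocalRatio_two_mul_add_one`, `archLocalRatio_twenty`, `archLocalRatio_twenty_bounds`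 | PROVED |
| §3 | `u_∞(s) = e^{2iθ(s)}`, `θ` = Riemann–Siegel angular function ([CMbook] Ch. II §5.1 Lemma 2.20; p0008:L40) | `archLocalRatio_half_add_eq_cexp` (over `Literature.NumberTheory.LFunctions.riemannSiegelTheta`) | PROVED |
| §3 | **Fact 3.6** inequality (3.1) fails in general — for `S = {∞}` it would force `θ` monotonic, "by looking at its graph … it is not the case" (p0008:L35–L43) | `riemannSiegelThetaDeriv_zero_neg`, `exists_riemannSiegelTheta_neg`, `not_monotoneOn_riemannSiegelTheta`, `not_antitoneOn_riemannSiegelTheta`; `exists_re_connesArchPV_autocorrelation_pos`, `not_semilocalTraceInequality_empty` | PROVED (the printed mechanism `θ` non-monotone, AND the failure of (3.1) at `S = {∞}` by an explicit dilated test function, via the tree's `re_weilArchTerm_comp_mul_le`) |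
| §4 | Weil's criterion form `f = g * g`, `∫g dx = ∫g d*x = 0`, compact support ([EB], [B3]; p0009:L3–L7); `h₁(x) = x^{1/2}g(x)`, `h = h₁ * h₁^*` (p0009:L8–L15); conditions (4.1) `∫ h₁(x) x^{±1/2} d*x = 0`; "Weil's positivity corresponds well to (3.1) but one needs to impose the two conditions (4.1)" | tree: `Literature.NumberTheory.LFunctions.weil_criterion_holds`, `weilConv`, `weilReflect`, `WeilSemilocalPositivityOn`; here `weilMellin_one_eq_integral_exp_half`, `weilMellin_zero_eq_integral_exp_neg_half` ((4.1) = `ĝ₁(1) = ĝ₁(0) = 0` in the additive variable), the dictionary `connesLocalTerm_eq_weilSemilocalPrimeTerm_singleton`, `weilSemilocalCoeff_eq_sum_singleton`, `weilSemilocalPrimeTerm_eq_sum_singleton`, `sum_connesLocalTerm_eq_weilSemilocalPrimeTerm`, and `semilocalTraceInequality_iff` ((3.1) ⟺ `Re polar(g⋆g̃) ≤ Re Q_S(g)`), `weilPolarTerm_autocorrelation_eq_zero` | CITED + dictionary PROVED |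
| §4 | **Conjecture 4.1** (p0009:L22) | — | NOT vendored: a conjecture (programme statement), not a theorem; cited in `SemilocalTraceInequality`'s docstring and in `Literature.Barriers.RiemannHypothesis.SemilocalCutoffInnerCriterion` (evasions_known) |
| §4.1 | `E(f)(x) = |x|^{1/2} Σ_{n>0} f(nx)` (4.2); bicharacter `μ(v,s) = v^{−is}`, `𝔽_μ` (4.4)–(4.5); `𝔽_μ(f_n) = n^{−(1/2−is)}𝔽_μ(f)`; `u(s) = ζ(½−is)/ζ(½+is)` = ratio (3.4) by the functional equation (p0009:L26–L57) | `connesE`, `tsum_comp_div_eq_mul_tsum_fourier` (Poisson for dilates), `connesE_fourier_eq` ((4.3) for continuous even `f` with `f, f̂ = O(|x|⁻²)`, `f(0) = f̂(0) = 0`), `connesE_fourier_eq_of_schwartz`; `mellin_connesE` (`mellin (E f) (w − ½) = ζ(w) mellin f w`, `Re w > 1`, Schwartz `f` — the display `𝔽_μ(E f) = ζ(½−is)𝔽_μ(f)` in its region of convergence); Mathlib `mellin`, `mellin_comp_mul_left` (cited, not restated); `riemannZeta_one_sub_eq_archLocalRatio_mul`, `archLocalRatio_half_add_eq_zeta_div`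 | DEFINED / PROVED |
| §4.1 | `M_S`, `E_S(f)(x) = |x|^{1/2} Σ_{m∈M_S} f(mx)` (4.6), `Σ_{M_S} m^{−z} = ζ(z) ∏_{p∈S}(1 − p^{−z})` (p0009:L60–L67) | `coprimeMonoid`, `mem_coprimeMonoid_iff`, `mem_coprimeMonoid_empty_iff`, `mem_coprimeMonoid_iff_coprime`, `connesES`, `tsum_coprimeMonoid_cpow_eq_LSeries` (`= L(χ₀ mod N_S, z)`), `tsum_coprimeMonoid_cpow_eq` (`Re z > 1`) | DEFINED / PROVED (in print the identity is used "heuristically" at `z = ½ + is`; its analytic continuation there is Mathlib's `DirichletCharacter.LFunctionTrivChar_eq_mul_riemannZeta`) |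
| §4.1 | Kahane's Sonine elements: `Δ = D_u² + D_u`, `D_u f = x f′`, `Δf = x²f″ + 2xf′` (4.8), range satisfies `f(0) = f̂(0) = 0` (4.7) (p0010:L1–L10) | `scalingDerivation` (`D_u`), `kahaneOp`, `scalingDerivation_scalingDerivation`, `kahaneOp_eq_scalingDerivation`, `kahaneOp_eq_deriv` (`Δf = (x²f′)′`), `kahaneOp_apply_zero`, `integral_kahaneOp_eq_zero`; on `𝒮(ℝ, ℂ)`: `schwartzMulX`, `scalingDerivationS`, `kahaneOpS`, `fourier_scalingDerivationS` (`𝓕 D_u = −(1 + D_u) 𝓕`), `fourier_kahaneOpS` / `fourier_kahaneOp` ("`Δ` commutes with Fourier transform") | PROVED (pointwise calculus, `∫ Δf = 0` under the decay hypotheses that hold on `𝒮(ℝ)`, and the Fourier-commutation on `𝒮(ℝ, ℂ)`) |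
| §4.1 | Remark 4.2 `Δ₂ := D_u² − D_u` gives the tropical structure of the Scaling Site ([CCscal1] eq. (1)) | `kahaneOpAdj`, `kahaneOpAdj_eq_scalingDerivation` | PROVED (`Δ₂ f = x² f″`; the Scaling Site files `Literature/NumberTheory/ConnesConsani/ScalingSite*.lean` hold the structure; cite only) |
| §4.2–4.3 | prose (time vs energy; analysis vs geometry); zeros of `L(q^{−s})` are `Im s = (α_j + 2πk)/log q`-periodic (p0010:L17–L21) | `cpow_neg_add_period` | PROVED (the periodicity `q^{−(s + 2πi/log q)} = q^{−s}`) |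

## Dictionary with the tree (used throughout)

The paper's test function `f ∈ 𝒮(C_{ℚ,S})` of Thm 2.5 is Connes 1999's `h` and the tree's `g` in the additive
variable: `f(λ) = |λ|^{−1/2} g(log|λ|)` (`Literature.NumberTheory.ConnesConsani.connesRadial`), so the symmetric
test function of (2.29) is `h(w) = |w|^{1/2} f(w) = g(log|w|)`; `h₁ * h₂` (multiplicative convolution on
`ℝ₊^*`) with `h₂ = h₁^*`, `h₂(w) = conj h₁(w⁻¹)`, is `weilConv g₁ (weilReflect g₁)`; the archimedean principal
value `∫'_{ℝ^*} |w|^{1/2} h(w)/|1−w| d*w = ∫'_{ℝ^*} f(w⁻¹)/|1−w| d*w` is `connesArchPV g` and each finite place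
gives `connesLocalTerm p g`; by `connesArchPV_eq_neg_weilArchTerm` (PROVED in the tree) `∫'_{ℝ^*} = −W_∞` in
the normalisation of `WeilExplicit.lean`.  Conditions (4.1) are `weilMellin g₁ 1 = 0 ∧ weilMellin g₁ 0 = 0`.

## Deliberately NOT here

`L²(X_S)`, `𝔽_α`, `w`, `W_Λ`, `R_Λ`, traces of operators on `L²(X_S)` (Lemmas 2.2–2.4, Thm 2.5 left side,
(2.27), (3.2)); the Hardy space / Beurling inner functions as objects (Cor. 3.5 is given in its abstract
range-invariance form — the quasi-inner sequel, Connes–Consani J. Number Theory 2021, is typed elsewhere in this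
directory and owns `ρ_∞ = archLocalRatio`, `ρ_p = localFactorRatio` under those names if it lands first);
Conjecture 4.1; the semiclassical §1 (figures, Maslov phases).  The "formal level" displays of
§4.1 are typed in their regions of convergence (`Re > 1`), not on the critical line.  No `instance`, no `notation`, no new named fact (`def … : Prop` without proof) is introduced —
every `Prop`-valued definition below is a predicate with proved API, not a vendored result.
-/

noncomputable section

open Complex Filter Set MeasureTheory ContinuousLinearMap
open scoped Real Topology ComplexConjugate InnerProductSpace ComplexOrder FourierTransform

namespace Literature.NumberTheory.ConnesConsani2021

namespace ScalingHamiltonian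

open Literature.NumberTheory.LFunctions Literature.NumberTheory.ConnesConsani
open Literature.Barriers.RiemannHypothesis

/-! ## §2.1 Quantized calculus: `F² = 1`, the graded differential and `đ² = 0` -/

section QuantizedCalculus

variable {R : Type*} [Ring R]

/-- The graded quantized differential on "forms of degree `n`": `đω := Fω − (−1)ⁿ ωF`
(eq. (2.2)); for `n = 0` this is the commutator `[F, ω]` of eq. (2.1).
[cite: ConnesConsani2021ScalingHamiltonian, §2.1 eq. (2.2) (arXiv:1910.14368 p0005:L25–L28)] -/
def gradedQDiff (F : R) (n : ℕ) (ω : R) : R :=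
  F * ω - (-1) ^ n * (ω * F)

/-- Unfolding `gradedQDiff`: `đ_n ω = Fω − (−1)ⁿ ωF` (eq. (2.2)). [cite: ConnesConsani2021ScalingHamiltonian, §2.1 eq. (2.2) (p0005:L25–L28)] -/
theorem gradedQDiff_def (F : R) (n : ℕ) (ω : R) :
    gradedQDiff F n ω = F * ω - (-1) ^ n * (ω * F) := rfl

/-- Degree `0`: `đω = [F, ω] = Fω − ωF` (eq. (2.1)). [cite: ConnesConsani2021ScalingHamiltonian, §2.1 eq. (2.1) (p0005:L14–L16)] -/
theorem gradedQDiff_zero (F ω : R) : gradedQDiff F 0 ω = F * ω - ω * F := by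
  simp [gradedQDiff]

/-- **`đ² = 0`** ("One checks, using `F² = 1`, that the square of the differential is `0`", p0005:L29):
for `F² = 1`, `đ_{n+1}(đ_n ω) = 0`. [cite: ConnesConsani2021ScalingHamiltonian, §2.1 after eq. (2.2) (p0005:L29)] -/
theorem gradedQDiff_succ_gradedQDiff {F : R} (hF : F * F = 1) (n : ℕ) (ω : R) :
    gradedQDiff F (n + 1) (gradedQDiff F n ω) = 0 := by
  have hFF : ∀ x : R, F * (F * x) = x := fun x ↦ by rw [← mul_assoc, hF, one_mul]
  have hFF' : ∀ x : R, x * F * F = x := fun x ↦ by rw [mul_assoc, hF, mul_one]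
  rcases neg_one_pow_eq_or R n with h | h
  · have h' : ((-1 : R)) ^ (n + 1) = -1 := by rw [pow_succ, h, one_mul]
    rw [gradedQDiff, gradedQDiff, h, h', one_mul, neg_one_mul, sub_neg_eq_add, mul_sub, sub_mul, hFF,
      hFF', mul_assoc]
    abel
  · have h' : ((-1 : R)) ^ (n + 1) = 1 := by rw [pow_succ, h, neg_one_mul, neg_neg]
    rw [gradedQDiff, gradedQDiff, h, h', one_mul, neg_one_mul, sub_neg_eq_add, mul_add, add_mul, hFF,
      hFF', mul_assoc]
    abel

end QuantizedCalculus

section CutoffSign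

variable {H : Type*} [NormedAddCommGroup H] [InnerProductSpace ℂ H]

/-- **`F² = 1`** for `F = 2P − 1`, `P` an idempotent (Def. 2.1: "a self-adjoint operator `F` … with
`F² = 1`"; for the tree's `cutoffSign P = 2 • P − 1`). [cite: ConnesConsani2021ScalingHamiltonian, §2.1 before Def. 2.1 (p0005:L19–L20)] -/
theorem cutoffSign_mul_self {P : H →L[ℂ] H} (hP : IsIdempotentElem P) :
    cutoffSign P * cutoffSign P = 1 := by
  have hPP : P * P = P := hP.eq
  have h : cutoffSign P = (2 : ℂ) • P - 1 := rfl
  rw [h, sub_mul, mul_sub, one_mul, mul_one, smul_mul_assoc, mul_smul_comm, hPP]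
  simp only [two_smul]
  abel

/-- The tree's quantized differential `quantizedDiff P u = [F, u]` IS the degree-`0` graded differential for
`F = cutoffSign P`. [cite: ConnesConsani2021ScalingHamiltonian, Def. 2.1 eq. (2.7) (p0005:L55–L59)] -/
theorem quantizedDiff_eq_gradedQDiff (P u : H →L[ℂ] H) :
    quantizedDiff P u = gradedQDiff (cutoffSign P) 0 u := by
  rw [gradedQDiff_zero]; rfl

end CutoffSign

section Kernel

/-- The (formal) Schwartz kernel of the Hilbert transform `H = 2Π_{[0,∞]} − 1` on `L²(ℝ)`:
`(Hξ)(s) = (1/iπ) ∫ ξ(t)/(s−t) dt` (principal value), i.e. `K(s,t) = 1/(iπ(s−t))` (eq. (2.6)).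
Only the pointwise kernel is defined (Mathlib has no singular-integral Hilbert transform).
[cite: ConnesConsani2021ScalingHamiltonian, §2.1 eq. (2.6) (p0005:L49–L53)] -/
def hilbertKernel (s t : ℝ) : ℂ := 1 / (I * π * (s - t))

/-- The kernel of the quantized differential `đf = [H, f]`: `k(s,t) = (i/π)(f(s) − f(t))/(s − t)`
(eq. (2.8)). [cite: ConnesConsani2021ScalingHamiltonian, Def. 2.1 eq. (2.8) (p0005:L61–L64)] -/
def quantizedDiffKernel (f : ℝ → ℂ) (s t : ℝ) : ℂ := I / π * ((f s - f t) / (s - t))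

/-- **The kernel identity behind (2.8)**: the commutator of the Hilbert kernel with a multiplication operator,
`K(s,t) f(t) − f(s) K(s,t) = (i/π)(f(s) − f(t))/(s − t)` (off the diagonal).
[cite: ConnesConsani2021ScalingHamiltonian, Def. 2.1 eqs. (2.6)–(2.8) (p0005:L49–L64)] -/
theorem hilbertKernel_commutator (f : ℝ → ℂ) {s t : ℝ} (hst : s ≠ t) :
    hilbertKernel s t * f t - f s * hilbertKernel s t = quantizedDiffKernel f s t := by
  have hst' : (s : ℂ) - t ≠ 0 := by
    rw [sub_ne_zero]; exact_mod_cast hst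
  have hπ : (π : ℂ) ≠ 0 := by exact_mod_cast Real.pi_ne_zero
  simp only [hilbertKernel, quantizedDiffKernel]
  field_simp
  ring_nf
  simp only [Complex.I_sq]
  ring

end Kernel

/-! ## §2.2 The `S`-units `ℤ_S^* = {± p₁^{n₁} ⋯ p_k^{n_k}}` (eqs. (1.1), (2.14)) -/

section Units

/-- The group `ℤ_S^* = GL₁(ℤ_S) = {± p₁^{n₁}⋯p_k^{n_k} : p_j ∈ S ∖ {∞}, n_j ∈ ℤ}` of eqs. (1.1)/(2.14), as the
subgroup of `ℚˣ` of rationals whose `ℓ`-adic valuation vanishes at every prime `ℓ ∉ S` (`S` is given by its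
finite set of primes `P`; non-primes in `P` are ignored).  For `S = {p, q, ∞}` this is the explicit
`Literature.NumberTheory.ConnesConsani2024.Gamma p q`. [cite: ConnesConsani2021ScalingHamiltonian, §2.2 eq. (2.14) (p0005:L104–L109)] -/
def unitsZS (P : Finset ℕ) : Subgroup ℚˣ where
  carrier := {u | ∀ ℓ : ℕ, ℓ.Prime → ℓ ∉ P → padicValRat ℓ (u : ℚ) = 0}
  one_mem' := by intro ℓ _ _; simp
  mul_mem' := by
    intro u v hu hv ℓ hℓ hℓP
    haveI : Fact ℓ.Prime := ⟨hℓ⟩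
    rw [Units.val_mul, padicValRat.mul (Units.ne_zero u) (Units.ne_zero v), hu ℓ hℓ hℓP, hv ℓ hℓ hℓP,
      add_zero]
  inv_mem' := by
    intro u hu ℓ hℓ hℓP
    haveI : Fact ℓ.Prime := ⟨hℓ⟩
    rw [Units.val_inv_eq_inv_val, padicValRat.inv, hu ℓ hℓ hℓP, neg_zero]

/-- Membership in `ℤ_S^*`. [cite: ConnesConsani2021ScalingHamiltonian, §2.2 eq. (2.14) (p0005:L104–L109)] -/
theorem mem_unitsZS_iff {P : Finset ℕ} {u : ℚˣ} :
    u ∈ unitsZS P ↔ ∀ ℓ : ℕ, ℓ.Prime → ℓ ∉ P → padicValRat ℓ (u : ℚ) = 0 := Iff.rfl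

/-- `−1 ∈ ℤ_S^*` (the sign in `± ∏ p_j^{n_j}`). [cite: ConnesConsani2021ScalingHamiltonian, §1 eq. (1.1) (p0003:L10–L13)] -/
theorem neg_one_mem_unitsZS (P : Finset ℕ) : -1 ∈ unitsZS P := by
  intro ℓ hℓ _
  haveI : Fact ℓ.Prime := ⟨hℓ⟩
  rw [Units.val_neg, Units.val_one, padicValRat.neg, padicValRat.one]

/-- A prime `p` (as a unit of `ℚ`) lies in `ℤ_S^*` iff `p ∈ S`. [cite: ConnesConsani2021ScalingHamiltonian, §2.2 eq. (2.14) (p0005:L104–L109)] -/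
theorem prime_mem_unitsZS_iff {P : Finset ℕ} {p : ℕ} (hp : p.Prime) :
    Units.mk0 (p : ℚ) (by exact_mod_cast hp.ne_zero) ∈ unitsZS P ↔ p ∈ P := by
  haveI : Fact p.Prime := ⟨hp⟩
  constructor
  · intro h
    by_contra hpP
    have := h p hp hpP
    rw [Units.val_mk0, padicValRat.self hp.one_lt] at this
    exact one_ne_zero this
  · intro hpP ℓ hℓ hℓP
    haveI : Fact ℓ.Prime := ⟨hℓ⟩
    have hne : ℓ ≠ p := fun h ↦ hℓP (h ▸ hpP)
    rw [Units.val_mk0, padicValRat.of_nat, Nat.cast_eq_zero, padicValNat_primes hne]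

end Units

/-! ## §3 Facts 3.1 and 3.3 -/

section Facts

variable {E : Type*} [NormedAddCommGroup E] [InnerProductSpace ℂ E]

/-- **Fact 3.1** (finite-dimensional case): for positive operators `A, B` on a finite-dimensional Hilbert
space, `Tr(AB) ≥ 0`.  Printed for bounded positive `A, B` with `AB` trace class on any Hilbert space, via
`Spec^*(AB) = Spec^*(A^{1/2} B A^{1/2}) ≥ 0` and Lidskii; Mathlib has no trace class, so we give the
finite-dimensional statement (proof: `A = C*C`, `Tr(C*C B) = Tr(C B C*)`, and `C B C* ≥ 0`).  The matrix form is
the tree's `Literature.LinearAlgebra.Matrix.NearestPositiveSemidefinite.trace_mul_nonneg`.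
-- TODO(general form): trace-class `AB` on an infinite-dimensional Hilbert space.
[cite: ConnesConsani2021ScalingHamiltonian, §3 Fact 3.1 (p0007:L8–L14)] -/
theorem trace_mul_nonneg_of_nonneg [FiniteDimensional ℂ E] {A B : E →L[ℂ] E} (hA : 0 ≤ A) (hB : 0 ≤ B) :
    0 ≤ LinearMap.trace ℂ E ((A * B : E →L[ℂ] E) : E →ₗ[ℂ] E) := by
  obtain ⟨C, hC⟩ := CStarAlgebra.nonneg_iff_eq_star_mul_self.mp hA
  have hcomm : LinearMap.trace ℂ E ((A * B : E →L[ℂ] E) : E →ₗ[ℂ] E) =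
      LinearMap.trace ℂ E ((C * B * star C : E →L[ℂ] E) : E →ₗ[ℂ] E) := by
    rw [hC, mul_assoc, ContinuousLinearMap.toLinearMap_mul, LinearMap.trace_mul_comm,
      ← ContinuousLinearMap.toLinearMap_mul]
  have hpos : 0 ≤ C * B * star C := star_right_conjugate_nonneg hB C
  rw [hcomm]
  exact ((ContinuousLinearMap.isPositive_toLinearMap_iff _).2
    ((ContinuousLinearMap.nonneg_iff_isPositive _).1 hpos)).trace_nonneg

variable [CompleteSpace E]

/-- **Fact 3.3** in operator form: for `h₂ = h₁^*` the multiplication operators satisfy `ĥ₂ = (ĥ₁)*`, so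
`ĥ₁ ĥ₂ = ĥ₁ ĥ₁* ≥ 0` — an instance of `A A* ≥ 0` in the C⋆-algebra of bounded operators.
[cite: ConnesConsani2021ScalingHamiltonian, §3 Fact 3.3 (p0007:L25–L29)] -/
theorem mul_star_self_nonneg' (A : E →L[ℂ] E) : 0 ≤ A * star A :=
  mul_star_self_nonneg A

end Facts

/-! ## §3 Corollary 3.5 — Lemma 3.4 (iii) is the invariance of `range P` under `u*` -/

section InnerCriterion

variable {H : Type*} [NormedAddCommGroup H] [InnerProductSpace ℂ H] [CompleteSpace H]

/-- **Corollary 3.5 (abstract form).**  For an orthogonal projection `P` and any bounded `u`, condition (iii)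
of Lemma 3.4, `P u = P u P`, holds iff `u*` maps the range of `P` into itself ("The function `u*` is inner
if and only if it preserves the subspace which is the range of the projection `P`", proof of Cor. 3.5,
p0008:L1).  In the one-variable quantized calculus `P` is the Hardy projection `Π_{[0,∞]}` of eqs. (2.5)–(2.6) and
"`u*` preserves `range P`" is Beurling's definition of an inner function [Beu]; with that reading this is
Cor. 3.5 verbatim, and Lemma 3.4 itself is `Literature.Barriers.RiemannHypothesis.innerCriterion_tfae`.
[cite: ConnesConsani2021ScalingHamiltonian, §3 Cor. 3.5 and its proof (p0007:L66, p0008:L1)] -/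
theorem invariant_iff_range_stable_under_star {P : H →L[ℂ] H} (hP : IsStarProjection P) (u : H →L[ℂ] H) :
    P * u = P * u * P ↔ ∀ x : H, P x = x → P (star u x) = star u x := by
  have hPs : star P = P := hP.isSelfAdjoint.star_eq
  have hPP : ∀ y : H, P (P y) = P y := fun y ↦
    congrArg (fun T : H →L[ℂ] H ↦ T y) hP.isIdempotentElem.eq
  constructor
  · intro hinv x hx
    have hinv' : star u * P = P * star u * P := by
      have := congrArg star hinv
      simpa only [star_mul, hPs, mul_assoc] using this
    have key := congrArg (fun T : H →L[ℂ] H ↦ T x) hinv'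
    change (star u) (P x) = P ((star u) (P x)) at key
    rw [hx] at key
    exact key.symm
  · intro h
    have key : star u * P = P * (star u * P) := by
      ext y
      change (star u) (P y) = P ((star u) (P y))
      exact (h (P y) (hPP y)).symm
    have := congrArg star key
    simp only [star_mul, hPs, star_star] at this
    -- this : P * u = P * u * P  (up to association)
    simpa only [mul_assoc] using this

end InnerCriterion

/-! ## §3 The ratios of local factors `u_p` (3.3) and `φ` (3.4) -/

section LocalFactors

/-- The ratio of local factors at a finite prime on the critical line, as a function of `z = ½ + is`:
`u_p = (1 − p^{−(1−z)})/(1 − p^{−z})` (eq. (3.3)); it is `γ_p(z)/γ_p(1−z)` for `γ_p(z) = (1 − p^{−z})⁻¹`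
(the `ρ_p` of Connes–Consani, J. Number Theory 2021). [cite: ConnesConsani2021ScalingHamiltonian, §3 eq. (3.3) (p0008:L5–L8)] -/
def localFactorRatio (p : ℕ) (z : ℂ) : ℂ :=
  (1 - (p : ℂ) ^ (-(1 - z))) / (1 - (p : ℂ) ^ (-z))

/-- The ratio of archimedean local factors `φ(z) = π^{(1−z)/2 − z/2} Γ(z/2)/Γ((1−z)/2) = Γ_ℝ(z)/Γ_ℝ(1−z)`,
`Γ_ℝ(s) = π^{−s/2}Γ(s/2)` (eq. (3.4); `u_∞(s) = φ(½ + is)`; the `ρ_∞` of Connes–Consani, J. Number Theory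
2021).  At the poles of `Γ((1−z)/2)` (odd positive integers `z`) Mathlib's `Γ = 0` convention gives the correct
value `φ = 0`. [cite: ConnesConsani2021ScalingHamiltonian, §3 eq. (3.4) (p0008:L16–L19)] -/
def archLocalRatio (z : ℂ) : ℂ :=
  Gammaℝ z / Gammaℝ (1 - z)

/-- `φ` in the printed form `π^{(1−z)/2 − z/2} Γ(z/2) / Γ((1−z)/2)`. [cite: ConnesConsani2021ScalingHamiltonian, §3 eq. (3.4) (p0008:L16–L19)] -/
theorem archLocalRatio_eq_printed (z : ℂ) :
    archLocalRatio z = (π : ℂ) ^ ((1 - z) / 2 - z / 2) * Complex.Gamma (z / 2) / Complex.Gamma ((1 - z) / 2) := by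
  have hπ : (π : ℂ) ≠ 0 := by exact_mod_cast Real.pi_ne_zero
  have h1 : (π : ℂ) ^ (-(1 - z) / 2) ≠ 0 := by
    rw [Ne, Complex.cpow_eq_zero_iff]; exact fun h ↦ hπ h.1
  rw [archLocalRatio, Gammaℝ_def, Gammaℝ_def,
    show (1 - z) / 2 - z / 2 = (-z / 2) - (-(1 - z) / 2) by ring, Complex.cpow_sub _ _ hπ]
  field_simp

/-- The point `½ + is` of the critical line satisfies `1 − z = conj z` (private plumbing). [folklore] -/
private theorem one_sub_half_add_eq_conj (s : ℝ) : (1 : ℂ) - (1 / 2 + s * I) = conj (1 / 2 + s * I) := by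
  apply Complex.ext
  · norm_num
  · simp

/-- **`|φ| = 1` on the critical line**: "The function `φ(z)` is of modulus `1` for `z = ½ + is`"
(`Γ_ℝ(z̄) = conj Γ_ℝ(z)` and `Γ_ℝ ≠ 0` on `Re z > 0`). [cite: ConnesConsani2021ScalingHamiltonian, §3 after eq. (3.4) (p0008:L20)] -/
theorem norm_archLocalRatio_half_add (s : ℝ) : ‖archLocalRatio (1 / 2 + s * I)‖ = 1 := by
  set z : ℂ := 1 / 2 + s * I with hz
  have hre : 0 < z.re := by simp [hz]
  have hG : Gammaℝ z ≠ 0 := Gammaℝ_ne_zero_of_re_pos hre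
  rw [archLocalRatio, one_sub_half_add_eq_conj, Gammaℝ_conj, norm_div, Complex.norm_conj,
    div_self (norm_ne_zero_iff.2 hG)]

/-- For a natural base: `p^{conj w} = conj (p^w)` (private plumbing). [folklore] -/
private theorem natCast_cpow_conj {p : ℕ} (w : ℂ) : (p : ℂ) ^ conj w = conj ((p : ℂ) ^ w) := by
  have harg : (p : ℂ).arg ≠ π := by
    rw [show (p : ℂ) = ((p : ℝ) : ℂ) by simp, Complex.arg_ofReal_of_nonneg (Nat.cast_nonneg p)]
    exact Real.pi_ne_zero.symm
  rw [Complex.cpow_conj _ _ harg, show conj (p : ℂ) = (p : ℂ) from Complex.conj_natCast p]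

/-- `‖p^{−z}‖ = p^{−Re z}` for `p ≥ 1` (private plumbing). [folklore] -/
private theorem norm_natCast_cpow_neg {p : ℕ} (hp : 0 < p) (z : ℂ) : ‖(p : ℂ) ^ (-z)‖ = (p : ℝ) ^ (-z.re) := by
  rw [show (p : ℂ) = ((p : ℝ) : ℂ) by simp,
    Complex.norm_cpow_eq_rpow_re_of_pos (by exact_mod_cast hp : (0 : ℝ) < p)]
  simp

/-- On the open right half-plane the denominator of `u_p` does not vanish: `‖p^{−z}‖ = p^{−Re z} < 1`.
[cite: ConnesConsani2021ScalingHamiltonian, §3 after eq. (3.3) (p0008:L12)] -/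
theorem one_sub_cpow_neg_ne_zero {p : ℕ} (hp : 1 < p) {z : ℂ} (hz : 0 < z.re) :
    (1 : ℂ) - (p : ℂ) ^ (-z) ≠ 0 := by
  intro h
  have h1 : ‖(p : ℂ) ^ (-z)‖ = 1 := by rw [← (sub_eq_zero.1 h)]; simp
  rw [norm_natCast_cpow_neg (by omega) z] at h1
  have : (p : ℝ) ^ (-z.re) < 1 :=
    Real.rpow_lt_one_of_one_lt_of_neg (by exact_mod_cast hp) (by linarith)
  linarith

/-- **`|u_p| = 1` on the critical line**: "It is a function of modulus `1` for `s ∈ ℝ`" (numerator = conjugate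
of the denominator). [cite: ConnesConsani2021ScalingHamiltonian, §3 after eq. (3.3) (p0008:L9)] -/
theorem norm_localFactorRatio_half_add {p : ℕ} (hp : 1 < p) (s : ℝ) :
    ‖localFactorRatio p (1 / 2 + s * I)‖ = 1 := by
  set z : ℂ := 1 / 2 + s * I with hz
  have hre : 0 < z.re := by simp [hz]
  have hden : (1 : ℂ) - (p : ℂ) ^ (-z) ≠ 0 := one_sub_cpow_neg_ne_zero hp hre
  have hnum : (1 : ℂ) - (p : ℂ) ^ (-(1 - z)) = conj (1 - (p : ℂ) ^ (-z)) := by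
    rw [one_sub_half_add_eq_conj, ← map_neg, natCast_cpow_conj, map_sub, map_one]
  rw [localFactorRatio, hnum, norm_div, Complex.norm_conj, div_self (norm_ne_zero_iff.2 hden)]

/-- **The poles of `u_p`**: `1 − p^{−z} = 0 ⟺ z ∈ (2πi/log p)ℤ`.
[cite: ConnesConsani2021ScalingHamiltonian, §3 after eq. (3.3) (p0008:L9–L12)] -/
theorem one_sub_cpow_neg_eq_zero_iff {p : ℕ} (hp : 1 < p) (z : ℂ) :
    (1 : ℂ) - (p : ℂ) ^ (-z) = 0 ↔ ∃ k : ℤ, z = k * (2 * π * I / Real.log p) := by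
  have hp0 : (p : ℂ) ≠ 0 := by exact_mod_cast (show p ≠ 0 by omega)
  have hlog : (Real.log p : ℂ) ≠ 0 := by
    exact_mod_cast (Real.log_pos (by exact_mod_cast hp : (1 : ℝ) < p)).ne'
  have hlogp : Complex.log (p : ℂ) = (Real.log p : ℂ) := by
    rw [show (p : ℂ) = ((p : ℝ) : ℂ) by simp, Complex.ofReal_log (Nat.cast_nonneg p)]
  rw [sub_eq_zero, eq_comm, Complex.cpow_def_of_ne_zero hp0, hlogp, Complex.exp_eq_one_iff]
  constructor
  · rintro ⟨n, hn⟩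
    refine ⟨-n, ?_⟩
    rw [Int.cast_neg, mul_div_assoc', eq_div_iff hlog]
    linear_combination -hn
  · rintro ⟨k, hk⟩
    refine ⟨-k, ?_⟩
    rw [hk, Int.cast_neg]
    field_simp

/-- **`u_p` is holomorphic on the open right half-plane** ("in the right half-plane the denominator does not
vanish and the function is holomorphic"). [cite: ConnesConsani2021ScalingHamiltonian, §3 after eq. (3.3) (p0008:L12)] -/
theorem differentiableOn_localFactorRatio {p : ℕ} (hp : 1 < p) :
    DifferentiableOn ℂ (localFactorRatio p) {z : ℂ | 0 < z.re} := by
  have hp0 : (p : ℂ) ≠ 0 := by exact_mod_cast (show p ≠ 0 by omega)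
  intro z hz
  have h1 : DifferentiableAt ℂ (fun w : ℂ ↦ (1 : ℂ) - (p : ℂ) ^ (-(1 - w))) z :=
    (differentiableAt_const _).sub
      ((((differentiableAt_const (1 : ℂ)).sub differentiableAt_id).neg).const_cpow (Or.inl hp0))
  have h2 : DifferentiableAt ℂ (fun w : ℂ ↦ (1 : ℂ) - (p : ℂ) ^ (-w)) z :=
    (differentiableAt_const _).sub (differentiableAt_id.neg.const_cpow (Or.inl hp0))
  exact (h1.div h2 (one_sub_cpow_neg_ne_zero hp hz)).differentiableWithinAt

/-- `u_p` on the real axis: `u_p(x) = (1 − p^{x−1})/(1 − p^{−x})` with real powers — the form in which the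
source discusses its growth "for real values of `z`". [cite: ConnesConsani2021ScalingHamiltonian, §3 after eq. (3.3) (p0008:L12–L15)] -/
theorem localFactorRatio_ofReal (p : ℕ) (x : ℝ) :
    localFactorRatio p x = (((1 - (p : ℝ) ^ (x - 1)) / (1 - (p : ℝ) ^ (-x)) : ℝ) : ℂ) := by
  have hp0 : (0 : ℝ) ≤ p := Nat.cast_nonneg p
  have e1 : ((p : ℝ) : ℂ) ^ (-(1 - (x : ℂ))) = (((p : ℝ) ^ (x - 1) : ℝ) : ℂ) := by
    rw [Complex.ofReal_cpow hp0]
    congr 1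
    push_cast
    ring
  have e2 : ((p : ℝ) : ℂ) ^ (-(x : ℂ)) = (((p : ℝ) ^ (-x) : ℝ) : ℂ) := by
    rw [Complex.ofReal_cpow hp0]
    push_cast
    rfl
  rw [localFactorRatio, show (p : ℂ) = ((p : ℝ) : ℂ) by simp, e1, e2]
  push_cast
  rfl

/-- **`u_p(x) ∼ −p^{x−1}` as `x → +∞`** along the real axis ("it behaves as `−p^{z−1}`, `z → ∞`").
[cite: ConnesConsani2021ScalingHamiltonian, §3 after eq. (3.3) (p0008:L12–L15)] -/
theorem tendsto_localFactorRatio_div {p : ℕ} (hp : 1 < p) :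
    Tendsto (fun x : ℝ ↦ (1 - (p : ℝ) ^ (x - 1)) / (1 - (p : ℝ) ^ (-x)) / (-(p : ℝ) ^ (x - 1)))
      atTop (𝓝 1) := by
  have hp1 : (1 : ℝ) < p := by exact_mod_cast hp
  have hp0 : (0 : ℝ) < p := by linarith
  -- p^{-x} → 0 and p^{1-x} → 0
  have hA : Tendsto (fun x : ℝ ↦ (p : ℝ) ^ (-x)) atTop (𝓝 0) := by
    have h1 : Tendsto (fun x : ℝ ↦ ((p : ℝ) ^ x)⁻¹) atTop (𝓝 0) :=
      (tendsto_rpow_atTop_of_base_gt_one (p : ℝ) hp1).inv_tendsto_atTop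
    refine h1.congr' (Eventually.of_forall fun x ↦ ?_)
    show ((p : ℝ) ^ x)⁻¹ = (p : ℝ) ^ (-x)
    rw [Real.rpow_neg hp0.le]
  have hB : Tendsto (fun x : ℝ ↦ (p : ℝ) ^ (1 - x)) atTop (𝓝 0) := by
    have h := hA.const_mul (p : ℝ)
    rw [mul_zero] at h
    refine h.congr' (Eventually.of_forall fun x ↦ ?_)
    show (p : ℝ) * (p : ℝ) ^ (-x) = (p : ℝ) ^ (1 - x)
    rw [Real.rpow_sub hp0, Real.rpow_one, Real.rpow_neg hp0.le, div_eq_mul_inv]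
  have key : ∀ x : ℝ, (1 - (p : ℝ) ^ (x - 1)) / (1 - (p : ℝ) ^ (-x)) / (-(p : ℝ) ^ (x - 1)) =
      (1 - (p : ℝ) ^ (1 - x)) / (1 - (p : ℝ) ^ (-x)) := by
    intro x
    have hpx : (p : ℝ) ^ (x - 1) ≠ 0 := (Real.rpow_pos_of_pos hp0 _).ne'
    have hinv : (p : ℝ) ^ (1 - x) = ((p : ℝ) ^ (x - 1))⁻¹ := by
      rw [← Real.rpow_neg hp0.le, neg_sub]
    rw [hinv]
    field_simp
    ring
  simp_rw [key]
  have h := (hB.const_sub 1).div (hA.const_sub 1) (by norm_num)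
  rw [sub_zero, div_one] at h
  exact h

/-- **`|u_p(x)| → ∞`** along the real axis, hence `u_p ∉ H^∞` of the right half-plane.
[cite: ConnesConsani2021ScalingHamiltonian, §3 after eq. (3.3) (p0008:L12–L15)] -/
theorem tendsto_norm_localFactorRatio_atTop {p : ℕ} (hp : 1 < p) :
    Tendsto (fun x : ℝ ↦ ‖localFactorRatio p x‖) atTop atTop := by
  have hp1 : (1 : ℝ) < p := by exact_mod_cast hp
  have hp0 : (0 : ℝ) < p := by linarith
  -- |u_p(x)| = |ratio(x)| · p^{x-1} with ratio → 1 and p^{x-1} → ∞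
  have hgrow : Tendsto (fun x : ℝ ↦ (p : ℝ) ^ (x - 1)) atTop atTop := by
    have := tendsto_rpow_atTop_of_base_gt_one (p : ℝ) hp1
    have h2 : Tendsto (fun x : ℝ ↦ x - 1) atTop atTop := tendsto_atTop_add_const_right _ _ tendsto_id
    exact this.comp h2
  have hratio := (tendsto_localFactorRatio_div hp).norm
  rw [norm_one] at hratio
  have hprod := Tendsto.pos_mul_atTop one_pos hratio hgrow
  refine hprod.congr' ?_
  filter_upwards [eventually_gt_atTop (1 : ℝ)] with x hx
  have hpx : 0 < (p : ℝ) ^ (x - 1) := Real.rpow_pos_of_pos hp0 _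
  rw [localFactorRatio_ofReal p, Complex.norm_real, Real.norm_eq_abs, Real.norm_eq_abs, abs_div,
    abs_neg, abs_of_pos hpx, div_mul_cancel₀ _ hpx.ne']

/-- **`u_p` is unbounded on the half-plane `Re z > ½`** ("However it is not bounded", p0008:L12): so `u_p*`
is not inner and Cor. 3.5 does not apply ("none of the functions `u_v(s)*` fulfills the requirement of
Corollary 3.5", p0008:L32). [cite: ConnesConsani2021ScalingHamiltonian, §3 (p0008:L12–L15, L32)] -/
theorem not_bddAbove_norm_localFactorRatio {p : ℕ} (hp : 1 < p) :
    ¬ BddAbove ((fun z : ℂ ↦ ‖localFactorRatio p z‖) '' {z : ℂ | 1 / 2 < z.re}) := by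
  rintro ⟨M, hM⟩
  have h := (tendsto_norm_localFactorRatio_atTop hp).eventually_gt_atTop M
  obtain ⟨x, hx1, hx2⟩ := (h.and (eventually_gt_atTop 1)).exists
  have hmem : ‖localFactorRatio p x‖ ∈ (fun z : ℂ ↦ ‖localFactorRatio p z‖) '' {z : ℂ | 1 / 2 < z.re} :=
    ⟨x, by simp; linarith, rfl⟩
  exact absurd (hM hmem) (not_le.2 hx1)

/-- **`φ` vanishes at the odd positive integers** (`Γ((1−z)/2)` has a pole there; "the function `φ(z)` that
vanishes at odd integers", p0008:L28). [cite: ConnesConsani2021ScalingHamiltonian, §3 (p0008:L28)] -/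
theorem archLocalRatio_two_mul_add_one (k : ℕ) : archLocalRatio (2 * k + 1) = 0 := by
  rw [archLocalRatio]
  have : Gammaℝ (1 - (2 * k + 1)) = 0 := by
    rw [Gammaℝ_eq_zero_iff]
    exact ⟨k, by ring⟩
  rw [this, div_zero]

/-- **The complement-formula form of `φ`**: `φ(z) = π^{−½−z} Γ(z/2) Γ((1+z)/2) sin(π(1+z)/2)`, valid off the
poles `z ∈ {−1, −3, −5, …}` of `Γ((1+z)/2)` (from `Γ(x)Γ(1−x) = π/sin(πx)` with `x = (1+z)/2`).
[cite: ConnesConsani2021ScalingHamiltonian, §3 displays after eq. (3.4) (p0008:L20–L27)] -/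
theorem archLocalRatio_eq_sin {z : ℂ} (hz : ∀ n : ℕ, (1 + z) / 2 ≠ -n) :
    archLocalRatio z =
      (π : ℂ) ^ (-(1 / 2 : ℂ) - z) * Complex.Gamma (z / 2) * Complex.Gamma ((1 + z) / 2) *
        Complex.sin (π * ((1 + z) / 2)) := by
  have hπ : (π : ℂ) ≠ 0 := by exact_mod_cast Real.pi_ne_zero
  have hG : Complex.Gamma ((1 + z) / 2) ≠ 0 := by
    rw [Ne, Complex.Gamma_eq_zero_iff, not_exists]
    exact fun n ↦ hz n
  -- complement formula at x = (1+z)/2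
  have hc := Complex.Gamma_mul_Gamma_one_sub ((1 + z) / 2)
  rw [show (1 : ℂ) - (1 + z) / 2 = (1 - z) / 2 by ring] at hc
  -- hence Γ((1-z)/2)⁻¹ = sin(π(1+z)/2) Γ((1+z)/2) / π  (also when the sine vanishes)
  have hinv : (Complex.Gamma ((1 - z) / 2))⁻¹ =
      Complex.sin (π * ((1 + z) / 2)) * Complex.Gamma ((1 + z) / 2) / π := by
    by_cases hs : Complex.sin (π * ((1 + z) / 2)) = 0
    · have h0 : Complex.Gamma ((1 + z) / 2) * Complex.Gamma ((1 - z) / 2) = 0 := by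
        rw [hc, hs, div_zero]
      have hG' : Complex.Gamma ((1 - z) / 2) = 0 := (mul_eq_zero.1 h0).resolve_left hG
      rw [hG', hs, inv_zero, zero_mul, zero_div]
    · have hc' : Complex.Gamma ((1 + z) / 2) * Complex.Gamma ((1 - z) / 2) *
          Complex.sin (π * ((1 + z) / 2)) = π := by
        rw [hc, div_mul_cancel₀ _ hs]
      have hG' : Complex.Gamma ((1 - z) / 2) =
          π / (Complex.sin (π * ((1 + z) / 2)) * Complex.Gamma ((1 + z) / 2)) := by
        rw [eq_div_iff (mul_ne_zero hs hG)]
        linear_combination hc'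
      rw [hG', inv_div]
  have hsplit : (π : ℂ) ^ (-(1 / 2 : ℂ) - z) =
      (π : ℂ) ^ (-z / 2) * ((π : ℂ) ^ (-(1 - z) / 2))⁻¹ * (π : ℂ)⁻¹ := by
    rw [← Complex.cpow_neg, ← Complex.cpow_neg_one, ← Complex.cpow_add _ _ hπ,
      ← Complex.cpow_add _ _ hπ]
    congr 1
    ring
  rw [archLocalRatio, Gammaℝ_def, Gammaℝ_def, div_eq_mul_inv, mul_inv, hinv, hsplit]
  field_simp

/-- `19‼ = 654729075` (private arithmetic). [folklore] -/
private theorem doubleFactorial_nineteen : Nat.doubleFactorial 19 = 654729075 := by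
  norm_num [Nat.doubleFactorial]

/-- **The printed value `φ(20) = 1856156927625/(8π^{20})`** ("the function `φ(z)` … takes very large
values on even integers such as `φ(20) = 1856156927625/(8π^{20}) ∼ 26.4562`"), exact:
`φ(20) = π^{−41/2} Γ(10) Γ(21/2) sin(21π/2) = π^{−20} · 9! · 19‼ / 2^{10}`.
[cite: ConnesConsani2021ScalingHamiltonian, §3 display before Fact 3.6 (p0008:L28–L31)] -/
theorem archLocalRatio_twenty :
    archLocalRatio 20 = (((1856156927625 : ℝ) / (8 * π ^ 20) : ℝ) : ℂ) := by
  have hz : ∀ n : ℕ, ((1 : ℂ) + 20) / 2 ≠ -(n : ℂ) := by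
    intro n h
    have := congrArg Complex.re h
    simp at this
    linarith [n.cast_nonneg (α := ℝ)]
  rw [archLocalRatio_eq_sin hz]
  have hG10 : Complex.Gamma ((20 : ℂ) / 2) = ((Nat.factorial 9 : ℕ) : ℂ) := by
    rw [show (20 : ℂ) / 2 = (9 : ℕ) + 1 by norm_num, Complex.Gamma_nat_eq_factorial]
  have hG212 : Complex.Gamma (((1 : ℂ) + 20) / 2) =
      (((Nat.doubleFactorial (2 * 10 - 1) : ℕ) * Real.sqrt π / 2 ^ 10 : ℝ) : ℂ) := by
    rw [show ((1 : ℂ) + 20) / 2 = (((10 : ℕ) + 1 / 2 : ℝ) : ℂ) by push_cast; norm_num,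
      Complex.Gamma_ofReal, Real.Gamma_nat_add_half]
  have hsin : Complex.sin (π * (((1 : ℂ) + 20) / 2)) = 1 := by
    rw [show (π : ℂ) * (((1 : ℂ) + 20) / 2) = ((π / 2 + (5 : ℕ) * (2 * π) : ℝ) : ℂ) by
      push_cast; ring, ← Complex.ofReal_sin, Real.sin_add_nat_mul_two_pi, Real.sin_pi_div_two,
      Complex.ofReal_one]
  have hpow : (π : ℂ) ^ (-(1 / 2 : ℂ) - 20) = ((π ^ (-(41 / 2) : ℝ) : ℝ) : ℂ) := by
    rw [Complex.ofReal_cpow Real.pi_pos.le]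
    congr 1
    push_cast
    norm_num
  -- real arithmetic: π^{-41/2} · 9! · (19‼ √π / 2^10) = 1856156927625 / (8 π^20)
  have hπ : (0 : ℝ) < π := Real.pi_pos
  have h19 : ((Nat.doubleFactorial (2 * 10 - 1) : ℕ) : ℝ) = 654729075 := by
    rw [show 2 * 10 - 1 = 19 by norm_num, doubleFactorial_nineteen]; norm_num
  have h9 : ((Nat.factorial 9 : ℕ) : ℝ) = 362880 := by norm_num [Nat.factorial]
  have hsq : Real.sqrt π = π ^ (1 / 2 : ℝ) := Real.sqrt_eq_rpow π
  have hcomb : (π : ℝ) ^ (-(41 / 2) : ℝ) * π ^ (1 / 2 : ℝ) = (π ^ 20)⁻¹ := by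
    rw [← Real.rpow_add hπ, show (-(41 / 2) : ℝ) + 1 / 2 = -(20 : ℕ) by norm_num,
      Real.rpow_neg hπ.le, Real.rpow_natCast]
  have key : (π : ℝ) ^ (-(41 / 2) : ℝ) * (362880 : ℝ) * (654729075 * Real.sqrt π / 2 ^ 10) =
      1856156927625 / (8 * π ^ 20) := by
    rw [hsq, show (π : ℝ) ^ (-(41 / 2) : ℝ) * (362880 : ℝ) * (654729075 * π ^ (1 / 2 : ℝ) / 2 ^ 10)
        = (π : ℝ) ^ (-(41 / 2) : ℝ) * π ^ (1 / 2 : ℝ) * (362880 * 654729075 / 2 ^ 10) by ring, hcomb]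
    field_simp
    norm_num
  rw [hG10, hG212, hsin, hpow, mul_one, h19,
    show ((Nat.factorial 9 : ℕ) : ℂ) = ((362880 : ℝ) : ℂ) by rw [← h9]; norm_cast,
    ← Complex.ofReal_mul, ← Complex.ofReal_mul, key]

/-- **`φ(20) ≃ 26.4562`**: `26.456 < φ(20) < 26.4565` (from `3.141592 < π < 3.141593`).
[cite: ConnesConsani2021ScalingHamiltonian, §3 display before Fact 3.6 (p0008:L28–L31)] -/
theorem archLocalRatio_twenty_bounds :
    (26.456 : ℝ) < 1856156927625 / (8 * π ^ 20) ∧ (1856156927625 : ℝ) / (8 * π ^ 20) < 26.4565 := by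
  have h1 : (3.141592 : ℝ) < π := Real.pi_gt_d6
  have h2 : π < (3.141593 : ℝ) := Real.pi_lt_d6
  have hπ : (0 : ℝ) < π := Real.pi_pos
  have hlo : (3.141592 : ℝ) ^ 20 < π ^ 20 := pow_lt_pow_left₀ h1 (by norm_num) (by norm_num)
  have hhi : π ^ 20 < (3.141593 : ℝ) ^ 20 := pow_lt_pow_left₀ h2 hπ.le (by norm_num)
  have hpos : (0 : ℝ) < 8 * π ^ 20 := by positivity
  constructor
  · rw [lt_div_iff₀ hpos]
    nlinarith
  · rw [div_lt_iff₀ hpos]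
    nlinarith

/-- **`ζ(1 − z) = φ(z) ζ(z)`**: the ratio of archimedean local factors is the quotient in the functional
equation ("By the functional equation this quotient is the ratio (3.4) of archimedean local factors",
§4.1 p0009:L53–L57), for `z ≠ 1` off the trivial-zero poles `z ∈ −2ℕ` of `Γ_ℝ` (Mathlib:
`completedRiemannZeta_one_sub`, `riemannZeta_def_of_ne_zero`). [cite: ConnesConsani2021ScalingHamiltonian, §4.1 (p0009:L49–L57)] -/
theorem riemannZeta_one_sub_eq_archLocalRatio_mul {z : ℂ} (hz1 : z ≠ 1) (hz : ∀ n : ℕ, z ≠ -(2 * (n : ℂ))) :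
    riemannZeta (1 - z) = archLocalRatio z * riemannZeta z := by
  have hz0 : z ≠ 0 := by simpa using hz 0
  have hG : Gammaℝ z ≠ 0 := by
    rw [Ne, Gammaℝ_eq_zero_iff, not_exists]; exact hz
  have h1z : (1 : ℂ) - z ≠ 0 := sub_ne_zero.2 (Ne.symm hz1)
  rw [riemannZeta_def_of_ne_zero hz0, riemannZeta_def_of_ne_zero h1z, completedRiemannZeta_one_sub,
    archLocalRatio]
  by_cases h : Gammaℝ (1 - z) = 0
  · simp [h]
  · field_simp

/-- **`u(s) = ζ(½ − is)/ζ(½ + is)`** on the critical line (away from the zeros of `ζ`), the "formal level"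
identity of §4.1 made exact by the functional equation. [cite: ConnesConsani2021ScalingHamiltonian, §4.1 (p0009:L53–L57)] -/
theorem archLocalRatio_half_add_eq_zeta_div {s : ℝ} (hζ : riemannZeta (1 / 2 + s * I) ≠ 0) :
    archLocalRatio (1 / 2 + s * I) = riemannZeta (1 / 2 - s * I) / riemannZeta (1 / 2 + s * I) := by
  have hz1 : (1 / 2 : ℂ) + s * I ≠ 1 := by
    intro h; have := congrArg Complex.re h; norm_num at this
  have hz : ∀ n : ℕ, (1 / 2 : ℂ) + s * I ≠ -(2 * (n : ℂ)) := by
    intro n h; have := congrArg Complex.re h; simp at this; linarith [n.cast_nonneg (α := ℝ)]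
  have h := riemannZeta_one_sub_eq_archLocalRatio_mul hz1 hz
  rw [show (1 : ℂ) - (1 / 2 + s * I) = 1 / 2 - s * I by ring] at h
  rw [h, mul_div_cancel_right₀ _ hζ]

end LocalFactors

/-! ## §3 `u_∞ = e^{2iθ}` and Fact 3.6: `θ` is not monotonic; inequality (3.1) fails for `S = {∞}` -/

section RiemannSiegel

open Literature.Analysis.SpecialFunctions

/-- **`u_∞(t) = φ(½ + it) = e^{2iθ(t)}`** with `θ` the Riemann–Siegel angular function of the tree
(`riemannSiegelTheta`; "`u_∞(s) = e^{2iθ(s)}` where `θ(s)` is the Riemann–Siegel angular function",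
[CMbook] Ch. II §5.1 Lemma 2.20), from the tree's phase identity `e^{iθ(t)} = G/|G|`,
`G = π^{−it/2}Γ(¼ + it/2)`, and `Γ_ℝ(½ ± it) = π^{−1/4} G`, `π^{−1/4} Ḡ`.
[cite: ConnesConsani2021ScalingHamiltonian, §3 proof of Fact 3.6 (p0008:L40)] -/
theorem archLocalRatio_half_add_eq_cexp (t : ℝ) :
    archLocalRatio (1 / 2 + t * I) = cexp (2 * riemannSiegelTheta t * I) := by
  set G := thetaGamma (thetaArg t) with hGdef
  have hG0 : G ≠ 0 := thetaGamma_thetaArg_ne_zero t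
  have hc : ((Real.exp (-Real.log π / 4) : ℝ) : ℂ) ≠ 0 := by exact_mod_cast (Real.exp_pos _).ne'
  have hnum : Gammaℝ (1 / 2 + t * I) = ((Real.exp (-Real.log π / 4) : ℝ) : ℂ) * G :=
    Gammaℝ_half_add_mul_I t
  have hden : Gammaℝ (1 - (1 / 2 + t * I)) = ((Real.exp (-Real.log π / 4) : ℝ) : ℂ) * conj G := by
    rw [one_sub_half_add_eq_conj, Gammaℝ_conj, hnum, map_mul, Complex.conj_ofReal]
  have hexp : cexp (2 * riemannSiegelTheta t * I) = (G / ‖G‖) ^ 2 := by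
    rw [← cexp_theta_mul_I_eq_thetaGamma_div_norm, ← Complex.exp_nat_mul]
    congr 1
    push_cast
    ring
  have hGG : G * conj G = ((‖G‖ : ℝ) : ℂ) ^ 2 := by
    rw [Complex.mul_conj, Complex.normSq_eq_norm_sq]; push_cast; ring
  have hn0 : ((‖G‖ : ℝ) : ℂ) ≠ 0 := by exact_mod_cast (norm_ne_zero_iff.2 hG0)
  have hcG : conj G ≠ 0 := (map_ne_zero _).2 hG0
  rw [archLocalRatio, hnum, hden, hexp, mul_div_mul_left _ _ hc, div_pow,
    div_eq_div_iff hcG (pow_ne_zero 2 hn0)]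
  linear_combination (-G) * hGG

/-- **`θ′(0) < 0`**: `θ′(0) = (Re ψ(¼) − log π)/2` with `ψ(¼) = −γ − π/2 − 3 log 2 < −4.149` (Gauss;
tree `reDigammaQuarter_zero_lt_neg`) and `log π > 1`. [cite: ConnesConsani2021ScalingHamiltonian, §3 proof of Fact 3.6 and Figure (riemannsiegel) (p0008:L39–L43)] -/
theorem riemannSiegelThetaDeriv_zero_neg : riemannSiegelThetaDeriv 0 < 0 := by
  have h1 : riemannSiegelThetaDeriv 0 = (reDigammaQuarter 0 - Real.log π) / 2 := by
    simp only [riemannSiegelThetaDeriv, reDigammaQuarter]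
    ring
  rw [h1]
  have h2 := reDigammaQuarter_zero_lt_neg
  have h3 := one_lt_log_pi
  linarith

/-- **`θ` dips below `0` right after `t = 0`**: there is `t > 0` with `θ(t) < 0 = θ(0)` (`θ′` is continuous
and `θ′(0) < 0`). [cite: ConnesConsani2021ScalingHamiltonian, §3 proof of Fact 3.6 and Figure (riemannsiegel) (p0008:L39–L43)] -/
theorem exists_riemannSiegelTheta_neg : ∃ t : ℝ, 0 < t ∧ riemannSiegelTheta t < 0 := by
  have hcont : Continuous riemannSiegelThetaDeriv := continuous_riemannSiegelThetaDeriv_holds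
  have h0 := riemannSiegelThetaDeriv_zero_neg
  have hev : ∀ᶠ u in 𝓝 (0 : ℝ), riemannSiegelThetaDeriv u < 0 := (hcont.tendsto 0).eventually (gt_mem_nhds h0)
  obtain ⟨δ, hδ, hball⟩ := Metric.eventually_nhds_iff.1 hev
  have hneg : ∀ u : ℝ, |u| < δ → riemannSiegelThetaDeriv u < 0 := fun u hu ↦
    hball (by simpa [Real.dist_eq] using hu)
  refine ⟨δ / 2, by positivity, ?_⟩
  have hanti : StrictAntiOn riemannSiegelTheta (Icc 0 (δ / 2)) := by
    refine strictAntiOn_of_deriv_neg (convex_Icc _ _)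
      (fun x _ ↦ (hasDerivAt_riemannSiegelTheta_holds x).continuousAt.continuousWithinAt) ?_
    intro x hx
    rw [interior_Icc] at hx
    rw [(hasDerivAt_riemannSiegelTheta_holds x).deriv]
    exact hneg x (by rw [abs_of_pos hx.1]; linarith [hx.2])
  have h := hanti (left_mem_Icc.2 (by positivity)) (right_mem_Icc.2 (by positivity)) (by positivity)
  rwa [riemannSiegelTheta_zero] at h

/-- **The Riemann–Siegel angular function is not monotone increasing** on `[0, ∞)` ("one sees that it is
not the case", p0008:L43): `θ(0) = 0 > θ(t)` for some `t > 0`.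
[cite: ConnesConsani2021ScalingHamiltonian, §3 Fact 3.6, proof (p0008:L37–L43)] -/
theorem not_monotoneOn_riemannSiegelTheta : ¬ MonotoneOn riemannSiegelTheta (Ici 0) := by
  obtain ⟨t, ht, hneg⟩ := exists_riemannSiegelTheta_neg
  intro hmono
  have h := hmono (self_mem_Ici (a := (0 : ℝ))) (mem_Ici.2 ht.le) ht.le
  rw [riemannSiegelTheta_zero] at h
  linarith

/-- **… nor monotone decreasing**: `θ(t) → +∞` (tree `tendsto_riemannSiegelTheta_atTop`) while `θ` is
negative somewhere.  Together: `θ` "is not a monotonic function".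
[cite: ConnesConsani2021ScalingHamiltonian, §3 Fact 3.6, proof (p0008:L37–L43)] -/
theorem not_antitoneOn_riemannSiegelTheta : ¬ AntitoneOn riemannSiegelTheta (Ici 0) := by
  obtain ⟨t, ht, hneg⟩ := exists_riemannSiegelTheta_neg
  intro hanti
  have hev := tendsto_riemannSiegelTheta_atTop.eventually_gt_atTop 0
  obtain ⟨T, hT1, hT2⟩ := (hev.and (eventually_ge_atTop t)).exists
  have h := hanti (mem_Ici.2 ht.le) (mem_Ici.2 (ht.le.trans hT2)) hT2
  linarith

/-- **Inequality (3.1)** of the source for `S = {∞} ∪ P` (`P` a finite set of primes), in the tree's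
variables: for every test function `g₁` (the paper's `h₁(x) = g₁(log x)`), with `h = h₁ * h₁^*` ↔
`k = weilConv g₁ (weilReflect g₁)`,
`Σ_{v ∈ S} ∫'_{ℚ_v^*} |w|^{1/2} h(w)/|1−w| d*w = Σ_{p ∈ P} connesLocalTerm p k + connesArchPV k ≤ 0` (real part;
the sum is real).  This is the inequality X.-J. Li's cutoff would have proved (p0007:L19–L24); with the two
vanishing conditions (4.1) and support in `(q^{−1/2}, q^{1/2})`, `P = {p < q}`, it is Weil's inequality for
those test functions (Fact 3.2; the source's §4 programme statement about this range is NOT vendored — see the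
module docstring).  A PREDICATE, refuted below for `P = ∅` (Fact 3.6); not a vendored result.
[cite: ConnesConsani2021ScalingHamiltonian, §3 eq. (3.1) (p0007:L19–L24) and §4 (p0009:L3–L19)] -/
def SemilocalTraceInequality (P : Finset ℕ) : Prop :=
  ∀ g : ℝ → ℂ, IsWeilTest g →
    (∑ p ∈ P, connesLocalTerm p (weilConv g (weilReflect g)) +
      connesArchPV (weilConv g (weilReflect g))).re ≤ 0

/-- **The archimedean principal value of an autocorrelation can be positive**: there is a test function
`g` with `Re ∫'_{ℝ^*} |w|^{1/2} h(w)/|1−w| d*w > 0`, `h ↔ g ⋆ g̃`.  Proof (RH-free, from the tree): for a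
normalised `g₁` and its unitary dilate `g_c` (support `∼ 1/c`), `∫'_{ℝ^*}(g_c ⋆ g̃_c) = −W_∞(g_c ⋆ g̃_c)`
(`connesArchPV_eq_neg_weilArchTerm`) and `Re W_∞(g_c ⋆ g̃_c) ≤ ψ(¼) − log π + 27c²D/(2π) < −4.149 − 1 + 1/6`
(`re_weilArchTerm_comp_mul_le`). [cite: ConnesConsani2021ScalingHamiltonian, §3 Fact 3.6 (p0008:L35–L43)] -/
theorem exists_re_connesArchPV_autocorrelation_pos :
    ∃ g : ℝ → ℂ, IsWeilTest g ∧ 0 < (connesArchPV (weilConv g (weilReflect g))).re := by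
  obtain ⟨g₁, hg₁, -, hn₁⟩ := exists_isWeilTest_sphere zero_lt_one
  set D : ℝ := ∫ u : ℝ, ‖weilMellin g₁ (1 / 2 + u * I)‖ ^ 2 * u ^ 2 with hD
  have hD0 : 0 ≤ D := integral_nonneg fun u ↦ by positivity
  set c : ℝ := (Real.sqrt (1 + 27 * D))⁻¹ with hc
  have hR : 0 < Real.sqrt (1 + 27 * D) := Real.sqrt_pos.2 (by positivity)
  have hc0 : 0 < c := inv_pos.2 hR
  have hc2 : c ^ 2 * (1 + 27 * D) = 1 := by
    rw [hc, inv_pow, Real.sq_sqrt (by positivity), inv_mul_cancel₀ (by positivity)]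
  set η : ℝ := c - 1 with hη
  have hη1 : -1 < η := by rw [hη]; linarith
  have hcη : 1 + η = c := by rw [hη]; ring
  set gc : ℝ → ℂ := weilDilate η g₁ with hgc
  have hgct : IsWeilTest gc := hg₁.weilDilate hη1
  refine ⟨gc, hgct, ?_⟩
  have hk : weilConv gc (weilReflect gc) = fun t ↦ weilConv g₁ (weilReflect g₁) (c * t) := by
    rw [hgc, weilConv_weilDilate_weilReflect g₁ hη1, hcη]
  have hkt : IsWeilTest (weilConv gc (weilReflect gc)) := hgct.weilConv hgct.weilReflect
  rw [connesArchPV_eq_neg_weilArchTerm hkt, Complex.neg_re, hk]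
  have har := re_weilArchTerm_comp_mul_le hg₁ hn₁ hc0
  have hlast : 27 * c ^ 2 / (2 * π) * D ≤ 1 / 6 := by
    have hπ3 := Real.pi_gt_three
    have hcD : 27 * c ^ 2 * D ≤ 1 := by nlinarith [hc2, sq_nonneg c]
    rw [div_mul_eq_mul_div, div_le_iff₀ (by positivity)]
    nlinarith
  have hψ := reDigammaQuarter_zero_lt_neg
  have hlπ := one_lt_log_pi
  linarith

/-- **Fact 3.6** ("The inequality (3.1) does not hold in general"), witnessed as in print at `S = {∞}`.
[cite: ConnesConsani2021ScalingHamiltonian, §3 Fact 3.6 (p0008:L35–L43)] -/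
theorem not_semilocalTraceInequality_empty : ¬ SemilocalTraceInequality ∅ := by
  obtain ⟨g, hg, hpos⟩ := exists_re_connesArchPV_autocorrelation_pos
  intro h
  have h' := h g hg
  rw [Finset.sum_empty, zero_add] at h'
  linarith

end RiemannSiegel

/-! ## §4 Weil's positivity in the variables of the source: conditions (4.1) -/

section Weil

/-- Condition (4.1), `+`: `∫₀^∞ h₁(x) x^{1/2} d*x = ∫ g₁(t) e^{t/2} dt = ĝ₁(1)` for `h₁(x) = g₁(log x)`
(`weilMellin g s = ∫ g(t) e^{(s−½)t} dt`). [cite: ConnesConsani2021ScalingHamiltonian, §4 eq. (4.1) (p0009:L16–L19)] -/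
theorem weilMellin_one_eq_integral_exp_half (g : ℝ → ℂ) :
    weilMellin g 1 = ∫ t : ℝ, g t * cexp ((t : ℂ) / 2) := by
  unfold weilMellin
  congr 1
  funext t
  rw [show ((1 : ℂ) - 1 / 2) * t = t / 2 by ring]

/-- Condition (4.1), `−`: `∫₀^∞ h₁(x) x^{−1/2} d*x = ∫ g₁(t) e^{−t/2} dt = ĝ₁(0)`.
[cite: ConnesConsani2021ScalingHamiltonian, §4 eq. (4.1) (p0009:L16–L19)] -/
theorem weilMellin_zero_eq_integral_exp_neg_half (g : ℝ → ℂ) :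
    weilMellin g 0 = ∫ t : ℝ, g t * cexp (-(t : ℂ) / 2) := by
  unfold weilMellin
  congr 1
  funext t
  rw [show ((0 : ℂ) - 1 / 2) * t = -(t : ℂ) / 2 by ring]

/-! ### Dictionary: inequality (3.1) in the tree's semi-local Weil layer (`WeilSemilocalQuadratic.lean`) -/

/-- At the powers of a prime: `Λ_{{p}}(p^{m+1}) (p^{m+1})^{-1/2} = log p · p^{−(m+1)/2}` — the shell
`v_p(u) = ∓(m+1)` weight of `connesLocalTerm`. [cite: ConnesConsani2021ScalingHamiltonian, §2.3 eq. (2.28) (the local terms ∫'_{ℚ_p^*}, p0006:L96–L106)] -/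
theorem weilSemilocalCoeff_singleton_pow_succ {p : ℕ} (hp : p.Prime) (m : ℕ) :
    weilSemilocalCoeff {p} (p ^ (m + 1)) = Real.log p * (p : ℝ) ^ (-((m + 1 : ℕ) : ℝ) / 2) := by
  have hp0 : (0 : ℝ) ≤ p := Nat.cast_nonneg p
  unfold weilSemilocalCoeff
  rw [if_pos (by rw [Nat.primeFactors_prime_pow (Nat.succ_ne_zero m) hp]),
    ArithmeticFunction.vonMangoldt_apply_pow (Nat.succ_ne_zero m),
    ArithmeticFunction.vonMangoldt_apply_prime hp, Nat.cast_pow, Real.sqrt_eq_rpow, ← Real.rpow_natCast,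
    ← Real.rpow_mul hp0, neg_div, Real.rpow_neg hp0, div_eq_mul_inv]
  congr 2
  ring

/-- `Λ_P(n) n^{-1/2} = Σ_{p ∈ P} Λ_{{p}}(n) n^{-1/2}`: a prime power `ℓ^m` is `P`-smooth iff `ℓ ∈ P`, and then
exactly the summand `p = ℓ` sees it. [cite: ConnesConsani2021ScalingHamiltonian, §2.3 eq. (2.28) (sum over v ∈ S, p0006:L96–L106)] -/
theorem weilSemilocalCoeff_eq_sum_singleton (P : Finset ℕ) (n : ℕ) :
    weilSemilocalCoeff P n = ∑ p ∈ P, weilSemilocalCoeff {p} n := by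
  by_cases hpp : IsPrimePow n
  · obtain ⟨ℓ, m, hℓ, hm, rfl⟩ := (isPrimePow_nat_iff n).1 hpp
    have hpf : (ℓ ^ m).primeFactors = {ℓ} := Nat.primeFactors_prime_pow hm.ne' hℓ
    unfold weilSemilocalCoeff
    simp_rw [hpf, Finset.singleton_subset_singleton, Finset.singleton_subset_iff]
    rw [Finset.sum_ite_eq]
  · simp [weilSemilocalCoeff_of_not_isPrimePow _ hpp]

/-- **`∫'_{ℚ_p^*}` is the `{p}`-part of the semi-local prime term**: `connesLocalTerm p k =
weilSemilocalPrimeTerm {p} k` (reindexing `n = p^{m+1}`; no convergence hypothesis is needed, both sides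
being the same `tsum` up to zero terms). [cite: ConnesConsani2021ScalingHamiltonian, §2.3 Thm 2.5 / eq. (2.28), the term v = p (p0006:L98–L106)] -/
theorem connesLocalTerm_eq_weilSemilocalPrimeTerm_singleton {p : ℕ} (hp : p.Prime) (k : ℝ → ℂ) :
    connesLocalTerm p k = weilSemilocalPrimeTerm {p} k := by
  set c : ℕ → ℂ := fun n ↦ (weilSemilocalCoeff {p} n : ℂ) * (k (Real.log n) + k (-Real.log n)) with hc
  have hinj : Function.Injective (fun m : ℕ ↦ p ^ (m + 1)) := by
    intro a b h
    have := Nat.pow_right_injective hp.two_le h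
    simpa using this
  have hsupp : Function.support c ⊆ Set.range (fun m : ℕ ↦ p ^ (m + 1)) := by
    intro n hn
    rw [Function.mem_support] at hn
    have hcoef : weilSemilocalCoeff {p} n ≠ 0 := by
      intro h0; apply hn; simp [hc, h0]
    obtain ⟨-, m, rfl⟩ := weilSemilocalCoeff_singleton_ne_zero hcoef
    rcases m with _ | m
    · exfalso
      apply hcoef
      rw [pow_zero, weilSemilocalCoeff_of_not_isPrimePow _ not_isPrimePow_one]
    · exact ⟨m, rfl⟩
  unfold weilSemilocalPrimeTerm
  rw [← hinj.tsum_eq hsupp]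
  unfold connesLocalTerm
  congr 1
  funext m
  simp only [hc]
  rw [weilSemilocalCoeff_singleton_pow_succ hp m, Nat.cast_pow, Real.log_pow]
  push_cast
  ring

/-- The semi-local prime term splits over the primes of `S`: `Σ_{P-smooth n} = Σ_{p ∈ P} Σ_{n = p^m}` for a
bounded `k`. [cite: ConnesConsani2021ScalingHamiltonian, §2.3 eq. (2.28) (sum over v ∈ S, p0006:L96–L106)] -/
theorem weilSemilocalPrimeTerm_eq_sum_singleton (P : Finset ℕ) {k : ℝ → ℂ} {K : ℝ} (hK : ∀ x, ‖k x‖ ≤ K) :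
    weilSemilocalPrimeTerm P k = ∑ p ∈ P, weilSemilocalPrimeTerm {p} k := by
  have hK0 : 0 ≤ K := (norm_nonneg _).trans (hK 0)
  have hsum : ∀ p ∈ P, Summable fun n : ℕ ↦
      (weilSemilocalCoeff {p} n : ℂ) * (k (Real.log n) + k (-Real.log n)) := by
    intro p _
    refine Summable.of_norm_bounded ((summable_weilSemilocalCoeff_singleton p).mul_right (2 * K)) ?_
    intro n
    rw [norm_mul, Complex.norm_real, Real.norm_of_nonneg (weilSemilocalCoeff_nonneg _ _)]
    refine mul_le_mul_of_nonneg_left ?_ (weilSemilocalCoeff_nonneg _ _)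
    calc ‖k (Real.log n) + k (-Real.log n)‖ ≤ ‖k (Real.log n)‖ + ‖k (-Real.log n)‖ := norm_add_le _ _
      _ ≤ K + K := add_le_add (hK _) (hK _)
      _ = 2 * K := by ring
  unfold weilSemilocalPrimeTerm
  rw [← Summable.tsum_finsetSum hsum]
  congr 1
  funext n
  rw [weilSemilocalCoeff_eq_sum_singleton P n]
  push_cast
  rw [Finset.sum_mul]

/-- **The left side of (3.1) in the tree's normalisation**: for `S = {∞} ∪ P` (`P` primes) and a bounded `k`,
`Σ_{p ∈ P} ∫'_{ℚ_p^*} = weilSemilocalPrimeTerm P k` (the finite places of Connes' `S`-local Weil sum).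
[cite: ConnesConsani2021ScalingHamiltonian, §2.3 Thm 2.5 and §3 eq. (3.1) (p0006:L98–L106, p0007:L19–L24)] -/
theorem sum_connesLocalTerm_eq_weilSemilocalPrimeTerm {P : Finset ℕ} (hP : ∀ p ∈ P, p.Prime) {k : ℝ → ℂ}
    {K : ℝ} (hK : ∀ x, ‖k x‖ ≤ K) :
    ∑ p ∈ P, connesLocalTerm p k = weilSemilocalPrimeTerm P k := by
  rw [weilSemilocalPrimeTerm_eq_sum_singleton P hK]
  exact Finset.sum_congr rfl fun p hp ↦ connesLocalTerm_eq_weilSemilocalPrimeTerm_singleton (hP p hp) k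

/-- **(3.1) ⟺ "polar term ≤ semi-local Weil quadratic form"**: for `S = {∞} ∪ P`, `P` a finite set of primes,
inequality (3.1) for all `h = h₁ * h₁^*` says exactly `Re (k̂(0) + k̂(1)) ≤ Re W_S(k)`, `k = g ⋆ g̃`, with the
tree's `W_S = polar − (primes in S) + W_∞` (`weilSemilocalFunctional`) and `∫'_{ℝ^*} = −W_∞`
(`connesArchPV_eq_neg_weilArchTerm`).  This is the precise sense of "Weil's positivity corresponds well to
(3.1) but one needs to impose the two conditions (4.1)" (§4, p0009:L16–L19): under (4.1) the polar term of
`k` vanishes (`weilPolarTerm_weilConv_weilReflect`). [cite: ConnesConsani2021ScalingHamiltonian, §4 (p0009:L3–L19) with §3 eq. (3.1)] -/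
theorem semilocalTraceInequality_iff {P : Finset ℕ} (hP : ∀ p ∈ P, p.Prime) :
    SemilocalTraceInequality P ↔ ∀ g : ℝ → ℂ, IsWeilTest g →
      (weilPolarTerm (weilConv g (weilReflect g))).re ≤ (weilSemilocalQuadratic P g).re := by
  have key : ∀ g : ℝ → ℂ, IsWeilTest g →
      (∑ p ∈ P, connesLocalTerm p (weilConv g (weilReflect g)) +
          connesArchPV (weilConv g (weilReflect g))).re =
        (weilPolarTerm (weilConv g (weilReflect g))).re - (weilSemilocalQuadratic P g).re := by
    intro g hg
    have hkt : IsWeilTest (weilConv g (weilReflect g)) := hg.weilConv hg.weilReflect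
    have hK : ∀ x, ‖weilConv g (weilReflect g) x‖ ≤ ∫ u : ℝ, ‖g u‖ ^ 2 :=
      fun x ↦ norm_weilConv_weilReflect_le hg x
    rw [sum_connesLocalTerm_eq_weilSemilocalPrimeTerm hP hK, connesArchPV_eq_neg_weilArchTerm hkt]
    unfold weilSemilocalQuadratic weilSemilocalFunctional
    simp only [Complex.add_re, Complex.sub_re, Complex.neg_re]
    ring
  constructor
  · intro h g hg
    have := h g hg
    rw [key g hg] at this
    linarith
  · intro h g hg
    rw [key g hg]
    linarith [h g hg]

/-- Under the vanishing condition `ĝ(0) = 0` (or `ĝ(1) = 0`) of (4.1) the polar term of `g ⋆ g̃` vanishes, so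
for such `g` inequality (3.1) is `0 ≤ Re W_S(g ⋆ g̃)` — semi-local Weil positivity in the sense of the tree's
`WeilSemilocalPositivityOn`. [cite: ConnesConsani2021ScalingHamiltonian, §4 eq. (4.1) (p0009:L16–L19)] -/
theorem weilPolarTerm_autocorrelation_eq_zero {g : ℝ → ℂ} (hg : IsWeilTest g)
    (h : weilMellin g 0 = 0 ∨ weilMellin g 1 = 0) :
    weilPolarTerm (weilConv g (weilReflect g)) = 0 := by
  rw [weilPolarTerm_weilConv_weilReflect hg]
  rcases h with h | h <;> simp [h]

end Weil

/-! ## §4.1 The maps `E`, `E_S`, the monoid `M_S`, Kahane's operator `Δ = D_u² + D_u` -/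

section Poisson

/-- The map `E(f)(x) = |x|^{1/2} Σ_{n>0} f(nx)` of eq. (4.2) (on even `f ∈ 𝒮(ℝ)` with `f(0) = f̂(0) = 0` in
the source; defined here for any `f`, as a `tsum` over `n ≥ 1`). [cite: ConnesConsani2021ScalingHamiltonian, §4.1 eq. (4.2) (p0009:L26–L29)] -/
def connesE (f : ℝ → ℂ) (x : ℝ) : ℂ :=
  ((|x| ^ (1 / 2 : ℝ) : ℝ) : ℂ) * ∑' n : ℕ, f ((n + 1 : ℕ) * x)

/-- The multiplicative monoid `M_S` of positive integers prime to every `p ∈ S` (§4.1, before eq. (4.6)).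
[cite: ConnesConsani2021ScalingHamiltonian, §4.1 before eq. (4.6) (p0009:L60)] -/
def coprimeMonoid (P : Finset ℕ) : Submonoid ℕ where
  carrier := {m | 0 < m ∧ ∀ p ∈ P, p.Prime → ¬ p ∣ m}
  one_mem' := ⟨Nat.one_pos, fun p _ hp ↦ hp.not_dvd_one⟩
  mul_mem' := by
    rintro a b ⟨ha, ha'⟩ ⟨hb, hb'⟩
    refine ⟨Nat.mul_pos ha hb, fun p hpP hp hdvd ↦ ?_⟩
    rcases hp.dvd_mul.1 hdvd with h | h
    · exact ha' p hpP hp h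
    · exact hb' p hpP hp h

/-- Membership in `M_S`. [cite: ConnesConsani2021ScalingHamiltonian, §4.1 before eq. (4.6) (p0009:L60)] -/
theorem mem_coprimeMonoid_iff {P : Finset ℕ} {m : ℕ} :
    m ∈ coprimeMonoid P ↔ 0 < m ∧ ∀ p ∈ P, p.Prime → ¬ p ∣ m := Iff.rfl

/-- The semi-local map `E_S(f)(x) = |x|^{1/2} Σ_{m ∈ M_S} f(mx)` of eq. (4.6).
[cite: ConnesConsani2021ScalingHamiltonian, §4.1 eq. (4.6) (p0009:L61–L63)] -/
def connesES (P : Finset ℕ) (f : ℝ → ℂ) (x : ℝ) : ℂ :=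
  ((|x| ^ (1 / 2 : ℝ) : ℝ) : ℂ) * ∑' m : coprimeMonoid P, f ((m : ℕ) * x)

/-- For `S = {∞}` (`P = ∅`), `M_S` is all positive integers, so the sum in (4.6) is the sum over `n > 0` of
(4.2). [cite: ConnesConsani2021ScalingHamiltonian, §4.1 eqs. (4.2) and (4.6) (p0009:L26–L29, L60–L63)] -/
theorem mem_coprimeMonoid_empty_iff {m : ℕ} : m ∈ coprimeMonoid ∅ ↔ 0 < m := by
  simp [mem_coprimeMonoid_iff]

/-! ### `Σ_{m ∈ M_S} m^{−z} = ζ(z) ∏_{p ∈ S} (1 − p^{−z})` (the display after eq. (4.6)) -/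

/-- For `m ≠ 0`: `m ∈ M_S` iff `m` is prime to `N_S = ∏_{p ∈ S} p` (`S` given by its primes `P`).
[cite: ConnesConsani2021ScalingHamiltonian, §4.1 before eq. (4.6) (p0009:L60)] -/
theorem mem_coprimeMonoid_iff_coprime {P : Finset ℕ} (hP : ∀ p ∈ P, p.Prime) {m : ℕ} (hm : m ≠ 0) :
    m ∈ coprimeMonoid P ↔ m.Coprime (∏ p ∈ P, p) := by
  rw [mem_coprimeMonoid_iff, Nat.coprime_prod_right_iff]
  constructor
  · rintro ⟨-, h⟩ p hp
    exact (Nat.coprime_comm.1 ((hP p hp).coprime_iff_not_dvd.2 (h p hp (hP p hp))))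
  · intro h
    refine ⟨Nat.pos_of_ne_zero hm, fun p hp hpp hdvd ↦ ?_⟩
    exact (hpp.coprime_iff_not_dvd.1 (Nat.coprime_comm.1 (h p hp))) hdvd

/-- **The Dirichlet series over `M_S` is the `L`-series of the trivial character mod `N_S = ∏_{p∈S} p`**
("(4.6) produces sums for `L` functions which reduce, for the trivial character, to …"), as formal
series: `Σ_{m ∈ M_S} m^{−z} = L(χ₀ mod N_S, z)` for every `z` (both sides are the same `tsum`).
[cite: ConnesConsani2021ScalingHamiltonian, §4.1 after eq. (4.6) (p0009:L64–L67)] -/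
theorem tsum_coprimeMonoid_cpow_eq_LSeries {P : Finset ℕ} (hP : ∀ p ∈ P, p.Prime) (z : ℂ) :
    ∑' m : coprimeMonoid P, ((m : ℕ) : ℂ) ^ (-z) =
      LSeries (fun n ↦ (1 : DirichletCharacter ℂ (∏ p ∈ P, p)) n) z := by
  rw [show (∑' m : coprimeMonoid P, ((m : ℕ) : ℂ) ^ (-z)) =
      ∑' m : ((coprimeMonoid P : Submonoid ℕ) : Set ℕ), ((m : ℕ) : ℂ) ^ (-z) from rfl,
    tsum_subtype ((coprimeMonoid P : Submonoid ℕ) : Set ℕ) (fun m : ℕ ↦ (m : ℂ) ^ (-z)), LSeries]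
  congr 1
  funext n
  rcases eq_or_ne n 0 with rfl | hn
  · rw [LSeries.term_zero, Set.indicator_of_notMem]
    intro h
    exact (lt_irrefl 0) ((mem_coprimeMonoid_iff.1 h).1)
  · rw [LSeries.term_of_ne_zero hn]
    by_cases hc : n ∈ coprimeMonoid P
    · have hu : IsUnit ((n : ℕ) : ZMod (∏ p ∈ P, p)) :=
        (ZMod.isUnit_iff_coprime n _).2 ((mem_coprimeMonoid_iff_coprime hP hn).1 hc)
      rw [Set.indicator_of_mem (show n ∈ ((coprimeMonoid P : Submonoid ℕ) : Set ℕ) from hc),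
        MulChar.one_apply hu, Complex.cpow_neg, one_div]
    · have hu : ¬ IsUnit ((n : ℕ) : ZMod (∏ p ∈ P, p)) := fun h ↦
        hc ((mem_coprimeMonoid_iff_coprime hP hn).2 ((ZMod.isUnit_iff_coprime n _).1 h))
      rw [Set.indicator_of_notMem (show n ∉ ((coprimeMonoid P : Submonoid ℕ) : Set ℕ) from hc),
        MulChar.map_nonunit _ hu, zero_div]

/-- **`Σ_{m ∈ M_S} m^{−z} = ζ(z) ∏_{p ∈ S∖{∞}} (1 − p^{−z})`** in the region of absolute convergence
`Re z > 1` — the rigorous form of the display after eq. (4.6) (stated there "heuristically" at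
`z = ½ − is`; by Mathlib's `DirichletCharacter.LFunctionTrivChar_eq_mul_riemannZeta` the analytic
continuation `L(χ₀ mod N_S, z)` equals `ζ(z) ∏_{p∈S}(1 − p^{−z})` for every `z ≠ 1`, in particular on
the critical line). [cite: ConnesConsani2021ScalingHamiltonian, §4.1 after eq. (4.6) (p0009:L64–L68)] -/
theorem tsum_coprimeMonoid_cpow_eq {P : Finset ℕ} (hP : ∀ p ∈ P, p.Prime) {z : ℂ} (hz : 1 < z.re) :
    ∑' m : coprimeMonoid P, ((m : ℕ) : ℂ) ^ (-z) =
      riemannZeta z * ∏ p ∈ P, (1 - (p : ℂ) ^ (-z)) := by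
  haveI : NeZero (∏ p ∈ P, p) := ⟨Finset.prod_ne_zero_iff.2 fun p hp ↦ (hP p hp).ne_zero⟩
  have hz1 : z ≠ 1 := by
    intro h; rw [h] at hz; simp at hz
  rw [tsum_coprimeMonoid_cpow_eq_LSeries hP, ← DirichletCharacter.LFunction_eq_LSeries _ hz,
    show (1 : DirichletCharacter ℂ (∏ p ∈ P, p)).LFunction z =
      DirichletCharacter.LFunctionTrivChar (∏ p ∈ P, p) z from rfl,
    DirichletCharacter.LFunctionTrivChar_eq_mul_riemannZeta hz1, Nat.primeFactors_prod hP, mul_comm]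

/-! ### The Poisson summation formula in the form (4.3): `E(𝔽_{e_ℝ} f)(x) = E(f)(x⁻¹)` -/

/-- Fourier transform of a dilation: `𝓕(f(a·))(ξ) = |a|⁻¹ 𝓕f(ξ/a)` (private plumbing; change of variables).
[folklore] -/
private theorem fourier_comp_mul_left (f : ℝ → ℂ) {a : ℝ} (ha : a ≠ 0) (ξ : ℝ) :
    𝓕 (fun y : ℝ ↦ f (a * y)) ξ = (|a|⁻¹ : ℝ) • 𝓕 f (ξ / a) := by
  rw [Real.fourier_real_eq, Real.fourier_real_eq]
  have h : (fun v : ℝ ↦ 𝐞 (-(v * ξ)) • f (a * v)) =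
      fun v : ℝ ↦ (fun u : ℝ ↦ 𝐞 (-(u * (ξ / a))) • f u) (a * v) := by
    funext v
    simp only
    congr 3
    field_simp
  rw [h, Measure.integral_comp_mul_left (fun u : ℝ ↦ 𝐞 (-(u * (ξ / a))) • f u) a, abs_inv]

/-- Polynomial decay at infinity transfers to dilations (private plumbing). [folklore] -/
private theorem isBigO_comp_mul_rpow {f : ℝ → ℂ} {b : ℝ}
    (hf : f =O[cocompact ℝ] (fun x : ℝ ↦ |x| ^ (-b))) {a : ℝ} (ha : a ≠ 0) :
    (fun y : ℝ ↦ f (a * y)) =O[cocompact ℝ] (fun x : ℝ ↦ |x| ^ (-b)) := by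
  have hten : Tendsto (fun y : ℝ ↦ a * y) (cocompact ℝ) (cocompact ℝ) :=
    (Homeomorph.mulLeft₀ a ha).toCocompactMap.cocompact_tendsto'
  have h1 := hf.comp_tendsto hten
  refine h1.trans (Asymptotics.IsBigO.of_bound (|a| ^ (-b)) (Eventually.of_forall fun y ↦ ?_))
  simp only [Function.comp_apply, Real.norm_eq_abs]
  rw [abs_mul, Real.mul_rpow (abs_nonneg a) (abs_nonneg y),
    abs_of_nonneg (by positivity : (0 : ℝ) ≤ |a| ^ (-b) * |y| ^ (-b)),
    abs_of_nonneg (by positivity : (0 : ℝ) ≤ |y| ^ (-b))]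

/-- Summability over `ℤ` of the samples of an `O(|x|^{-2})` function (private plumbing). [folklore] -/
private theorem summable_int_of_isBigO {g : ℝ → ℂ}
    (hg : g =O[cocompact ℝ] (fun x : ℝ ↦ |x| ^ (-(2 : ℝ)))) : Summable fun n : ℤ ↦ g n :=
  summable_of_isBigO (Real.summable_abs_int_rpow one_lt_two) (hg.comp_tendsto Int.tendsto_coe_cofinite)

/-- A `ℤ`-indexed even sequence vanishing at `0` sums to twice its sum over `n ≥ 1` (private plumbing).
[folklore] -/
private theorem tsum_int_eq_two_mul {F : ℤ → ℂ} (hF : Summable F) (heven : ∀ n : ℤ, F (-n) = F n)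
    (h0 : F 0 = 0) : ∑' n : ℤ, F n = 2 * ∑' n : ℕ, F ((n : ℤ) + 1) := by
  have h1 : Summable fun n : ℕ ↦ F n := hF.comp_injective Nat.cast_injective
  have hinj : Function.Injective fun n : ℕ ↦ -((n : ℤ) + 1) := by
    intro a b h; simpa using h
  have h2 : Summable fun n : ℕ ↦ F (-((n : ℤ) + 1)) := hF.comp_injective hinj
  rw [tsum_of_nat_of_neg_add_one h1 (by exact_mod_cast h2), h1.tsum_eq_zero_add]
  simp only [Int.natCast_zero, h0, zero_add]
  have e : (fun n : ℕ ↦ F (-((n : ℤ) + 1))) = fun n : ℕ ↦ F ((n : ℤ) + 1) := by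
    funext n; exact heven _
  push_cast
  rw [e]
  ring

/-- An even function has an even Fourier transform (private plumbing). [folklore] -/
private theorem fourier_neg_of_even {f : ℝ → ℂ} (heven : ∀ y, f (-y) = f y) (ξ : ℝ) :
    𝓕 f (-ξ) = 𝓕 f ξ := by
  rw [← Real.fourierInv_eq_fourier_neg, Real.fourierInv_eq_fourier_comp_neg]
  have : (fun y : ℝ ↦ f (-y)) = f := funext heven
  rw [this]

/-- **The Poisson summation formula for the self-dual character `e_ℝ(x) = e^{−2πix}`, dilated**: for a
continuous `f` with `f, 𝓕f = O(|x|^{−2})` at infinity and `x > 0`, `Σ_{n∈ℤ} f(n/x) = x Σ_{n∈ℤ} 𝓕f(nx)`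
(Mathlib's `Real.tsum_eq_tsum_fourier_of_rpow_decay` applied to `f(x⁻¹·)`; `𝓕 = 𝔽_{e_ℝ}` of eq. (2.4)).
[cite: ConnesConsani2021ScalingHamiltonian, §4.1 eq. (4.3) and the sentence before it (p0009:L30–L34)] -/
theorem tsum_comp_div_eq_mul_tsum_fourier {f : ℝ → ℂ} (hc : Continuous f)
    (hf : f =O[cocompact ℝ] (fun x : ℝ ↦ |x| ^ (-(2 : ℝ))))
    (hFf : 𝓕 f =O[cocompact ℝ] (fun x : ℝ ↦ |x| ^ (-(2 : ℝ)))) {x : ℝ} (hx : 0 < x) :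
    ∑' n : ℤ, f (n / x) = x * ∑' n : ℤ, 𝓕 f (n * x) := by
  set g : ℝ → ℂ := fun y ↦ f (x⁻¹ * y) with hgdef
  have hx0 : x⁻¹ ≠ 0 := inv_ne_zero hx.ne'
  have hcg : Continuous g := hc.comp (continuous_const.mul continuous_id)
  have hg : g =O[cocompact ℝ] (fun x : ℝ ↦ |x| ^ (-(2 : ℝ))) := isBigO_comp_mul_rpow hf hx0
  have hFg_eq : 𝓕 g = fun ξ ↦ (x : ℂ) * 𝓕 f (x * ξ) := by
    funext ξ
    rw [hgdef, fourier_comp_mul_left f hx0, abs_of_pos (inv_pos.2 hx), inv_inv, div_inv_eq_mul,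
      Complex.real_smul, mul_comm ξ x]
  have hFg : 𝓕 g =O[cocompact ℝ] (fun x : ℝ ↦ |x| ^ (-(2 : ℝ))) := by
    rw [hFg_eq]
    exact (isBigO_comp_mul_rpow hFf hx.ne').const_mul_left (x : ℂ)
  have hP := Real.tsum_eq_tsum_fourier_of_rpow_decay hcg one_lt_two hg hFg 0
  simp only [zero_add, QuotientAddGroup.mk_zero, fourier_eval_zero, mul_one] at hP
  have e1 : (fun n : ℤ ↦ f (n / x)) = fun n : ℤ ↦ g n := by
    funext n; simp only [hgdef, div_eq_inv_mul]
  rw [e1, hP, hFg_eq]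
  simp only [mul_comm x]
  rw [tsum_mul_left]

/-- **Eq. (4.3): `E(𝔽_{e_ℝ} f)(x) = E(f)(x⁻¹)` for `x ∈ ℝ₊^*`**, "provided one takes the Fourier transform
`𝔽_{e_ℝ}` associated to the basic character `e_ℝ` for which the lattice `ℤ ⊂ ℝ` is self-dual", for even `f`
with `f(0) = f̂(0) = 0`.  The source proceeds "at the formal level"; here `f` is continuous with `f`, `𝓕f`
decaying like `|x|^{−2}` (e.g. `f ∈ 𝒮(ℝ)`), which makes Poisson summation available.
[cite: ConnesConsani2021ScalingHamiltonian, §4.1 eqs. (4.2)–(4.3) (p0009:L26–L34)] -/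
theorem connesE_fourier_eq {f : ℝ → ℂ} (hc : Continuous f)
    (hf : f =O[cocompact ℝ] (fun x : ℝ ↦ |x| ^ (-(2 : ℝ))))
    (hFf : 𝓕 f =O[cocompact ℝ] (fun x : ℝ ↦ |x| ^ (-(2 : ℝ))))
    (heven : ∀ y, f (-y) = f y) (h0 : f 0 = 0) (hF0 : 𝓕 f 0 = 0) {x : ℝ} (hx : 0 < x) :
    connesE (𝓕 f) x = connesE f x⁻¹ := by
  have hP := tsum_comp_div_eq_mul_tsum_fourier hc hf hFf hx
  have hSf : Summable fun n : ℤ ↦ f (n / x) := by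
    have := summable_int_of_isBigO (isBigO_comp_mul_rpow hf (inv_ne_zero hx.ne'))
    refine this.congr fun n ↦ ?_
    simp only [div_eq_inv_mul]
  have hSF : Summable fun n : ℤ ↦ 𝓕 f (n * x) := by
    have := summable_int_of_isBigO (isBigO_comp_mul_rpow hFf hx.ne')
    refine this.congr fun n ↦ ?_
    simp only [mul_comm]
  have hL := tsum_int_eq_two_mul hSf (fun n ↦ by push_cast; rw [neg_div, heven]) (by simpa using h0)
  have hR := tsum_int_eq_two_mul hSF (fun n ↦ by push_cast; rw [neg_mul, fourier_neg_of_even heven])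
    (by simpa using hF0)
  rw [hL, hR] at hP
  have hsum : ∑' n : ℕ, f (((n : ℤ) + 1 : ℤ) / x) =
      (x : ℂ) * ∑' n : ℕ, 𝓕 f (((n : ℤ) + 1 : ℤ) * x) := by
    calc ∑' n : ℕ, f (((n : ℤ) + 1 : ℤ) / x)
        = (2 * ∑' n : ℕ, f (((n : ℤ) + 1 : ℤ) / x)) / 2 := by ring
      _ = (x * (2 * ∑' n : ℕ, 𝓕 f (((n : ℤ) + 1 : ℤ) * x))) / 2 := by rw [hP]
      _ = (x : ℂ) * ∑' n : ℕ, 𝓕 f (((n : ℤ) + 1 : ℤ) * x) := by ring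
  unfold connesE
  have e1 : (fun n : ℕ ↦ f (((n + 1 : ℕ) : ℝ) * x⁻¹)) = fun n : ℕ ↦ f (((n : ℤ) + 1 : ℤ) / x) := by
    funext n; simp [div_eq_mul_inv]
  have e2 : (fun n : ℕ ↦ 𝓕 f (((n + 1 : ℕ) : ℝ) * x)) = fun n : ℕ ↦ 𝓕 f (((n : ℤ) + 1 : ℤ) * x) := by
    funext n; simp
  rw [e1, e2, hsum, ← mul_assoc]
  congr 1
  rw [abs_inv, abs_of_pos hx, Real.inv_rpow hx.le]
  have hx12 : (0 : ℝ) < x ^ (1 / 2 : ℝ) := Real.rpow_pos_of_pos hx _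
  have hsq : x ^ (1 / 2 : ℝ) * x ^ (1 / 2 : ℝ) = x := by
    rw [← Real.rpow_add hx]; norm_num
  have key : (x ^ (1 / 2 : ℝ))⁻¹ * x = x ^ (1 / 2 : ℝ) := by
    field_simp
    linarith [hsq]
  exact_mod_cast congrArg (fun r : ℝ ↦ (r : ℂ)) key.symm

/-- **Eq. (4.3) for even Schwartz functions with `f(0) = f̂(0) = 0`** — the setting of the source
("acting on even functions `f ∈ 𝒮(ℝ)` satisfying `f(0) = f̂(0) = 0`"). [cite: ConnesConsani2021ScalingHamiltonian, §4.1 eqs. (4.2)–(4.3) (p0009:L26–L34)] -/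
theorem connesE_fourier_eq_of_schwartz (f : SchwartzMap ℝ ℂ) (heven : ∀ y, f (-y) = f y) (h0 : f 0 = 0)
    (hF0 : 𝓕 (f : ℝ → ℂ) 0 = 0) {x : ℝ} (hx : 0 < x) :
    connesE (𝓕 (f : ℝ → ℂ)) x = connesE f x⁻¹ :=
  connesE_fourier_eq f.continuous (f.isBigO_cocompact_rpow (-2))
    ((SchwartzMap.fourierTransformCLM ℂ f).isBigO_cocompact_rpow (-2)) heven h0 hF0 hx

/-- **`𝔽_μ(E f)(s) = ζ(½ − is) 𝔽_μ(f)(s)` in its region of convergence**: with `𝔽_μ(h)(s) =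
∫₀^∞ h(v) v^{−is} d*v = mellin h (−is)` (eqs. (4.4)–(4.5)) and `w = ½ − is`, the source's display
"`𝔽_μ(E(f))(s) = ζ(½ − is) 𝔽_μ(f)(s)`" (obtained there "at this formal level" from
`𝔽_μ(f_n)(s) = n^{−(½−is)} 𝔽_μ(f)(s)`, `f_n(x) = x^{1/2} f(nx)` — Mathlib's `mellin_comp_mul_left`) reads
`mellin (E f) (w − ½) = ζ(w) · mellin f (w)`, and holds for every Schwartz `f` when `Re w > 1`
(Riemann's unfolding; tree lemma `Literature.NumberTheory.Automorphic.Meyer.mellin_tsum_comp_nat_mul`).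
[cite: ConnesConsani2021ScalingHamiltonian, §4.1 eqs. (4.4)–(4.5) and the two displays after them (p0009:L35–L53)] -/
theorem mellin_connesE (f : SchwartzMap ℝ ℂ) {w : ℂ} (hw : 1 < w.re) :
    mellin (connesE f) (w - 1 / 2) = riemannZeta w * mellin (fun t : ℝ ↦ f t) w := by
  have h1 : mellin (connesE f) (w - 1 / 2) =
      mellin (fun t : ℝ ↦ (t : ℂ) ^ (1 / 2 : ℂ) • ∑' n : ℕ, f (((n + 1 : ℕ) : ℝ) * t)) (w - 1 / 2) := by
    rw [mellin, mellin]
    refine setIntegral_congr_fun measurableSet_Ioi fun t ht ↦ ?_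
    have hcast : (((t ^ (1 / 2 : ℝ) : ℝ)) : ℂ) = (t : ℂ) ^ (1 / 2 : ℂ) := by
      rw [Complex.ofReal_cpow (le_of_lt (mem_Ioi.1 ht))]
      norm_num
    simp only [connesE, abs_of_pos (mem_Ioi.1 ht), smul_eq_mul, hcast]
  rw [h1, mellin_cpow_smul, show w - 1 / 2 + 1 / 2 = w by ring,
    Literature.NumberTheory.Automorphic.Meyer.mellin_tsum_comp_nat_mul f hw]

/-- The scaling Hamiltonian as a derivation: `D_u f(x) = x f′(x)` (§4.1, "our scaling Hamiltonian
`D_u(f)(x) := x f′(x)`"). [cite: ConnesConsani2021ScalingHamiltonian, §4.1 before eq. (4.8) (p0010:L6)] -/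
def scalingDerivation (f : ℝ → ℂ) (x : ℝ) : ℂ :=
  (x : ℂ) * deriv f x

/-- Kahane's operator `Δ f(x) = x² f″(x) + 2x f′(x)` of eq. (4.8) (`= (D_u² + D_u) f`, and the range of `Δ`
on `𝒮(ℝ)` lies in `{f(0) = 0, f̂(0) = 0}`). [cite: ConnesConsani2021ScalingHamiltonian, §4.1 eq. (4.8) (p0010:L6–L9)] -/
def kahaneOp (f : ℝ → ℂ) (x : ℝ) : ℂ :=
  (x : ℂ) ^ 2 * deriv (deriv f) x + 2 * x * deriv f x

/-- The "adjoint expression" `Δ₂ := D_u² − D_u` of Remark 4.2, i.e. `Δ₂ f(x) = x² f″(x)` (it provides the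
tropical structure of the Scaling Site, [CCscal1] eq. (1); see `Literature/NumberTheory/ConnesConsani/ScalingSite*.lean`).
[cite: ConnesConsani2021ScalingHamiltonian, §4.1 Remark 4.2 (p0010:L12–L13)] -/
def kahaneOpAdj (f : ℝ → ℂ) (x : ℝ) : ℂ :=
  (x : ℂ) ^ 2 * deriv (deriv f) x

/-- `D_u² f(x) = x f′(x) + x² f″(x)` when `f′` is differentiable at `x` (the computation behind (4.8)).
[cite: ConnesConsani2021ScalingHamiltonian, §4.1 eq. (4.8) (p0010:L6–L9)] -/
theorem scalingDerivation_scalingDerivation {f : ℝ → ℂ} {x : ℝ} (hf : DifferentiableAt ℝ (deriv f) x) :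
    scalingDerivation (scalingDerivation f) x = (x : ℂ) * deriv f x + (x : ℂ) ^ 2 * deriv (deriv f) x := by
  unfold scalingDerivation
  have h : HasDerivAt (fun y : ℝ ↦ (y : ℂ) * deriv f y) (1 * deriv f x + (x : ℂ) * deriv (deriv f) x) x :=
    ((hasDerivAt_id x).ofReal_comp).mul hf.hasDerivAt
  rw [h.deriv]
  ring

/-- **`Δ = D_u² + D_u`** ("the simple function `D_u² + D_u` of our scaling Hamiltonian … one gets
`Δ(f)(x) = x²f″(x) + 2xf′(x)`"). [cite: ConnesConsani2021ScalingHamiltonian, §4.1 eq. (4.8) (p0010:L6–L9)] -/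
theorem kahaneOp_eq_scalingDerivation {f : ℝ → ℂ} {x : ℝ} (hf : DifferentiableAt ℝ (deriv f) x) :
    kahaneOp f x = scalingDerivation (scalingDerivation f) x + scalingDerivation f x := by
  rw [scalingDerivation_scalingDerivation hf, kahaneOp, scalingDerivation]
  ring

/-- **`Δ₂ = D_u² − D_u`** (Remark 4.2). [cite: ConnesConsani2021ScalingHamiltonian, §4.1 Remark 4.2 (p0010:L12–L13)] -/
theorem kahaneOpAdj_eq_scalingDerivation {f : ℝ → ℂ} {x : ℝ} (hf : DifferentiableAt ℝ (deriv f) x) :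
    kahaneOpAdj f x = scalingDerivation (scalingDerivation f) x - scalingDerivation f x := by
  rw [scalingDerivation_scalingDerivation hf, kahaneOpAdj, scalingDerivation]
  ring

/-- **`Δ f = (x² f′)′`** — the integration-by-parts form behind "the integral of `Δ(f)` vanishes"
(p0010:L6). [cite: ConnesConsani2021ScalingHamiltonian, §4.1 before eq. (4.8) (p0010:L6)] -/
theorem kahaneOp_eq_deriv {f : ℝ → ℂ} {x : ℝ} (hf : DifferentiableAt ℝ (deriv f) x) :
    kahaneOp f x = deriv (fun y : ℝ ↦ (y : ℂ) ^ 2 * deriv f y) x := by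
  have h : HasDerivAt (fun y : ℝ ↦ (y : ℂ) ^ 2 * deriv f y)
      ((2 : ℕ) * (x : ℂ) ^ (2 - 1) * 1 * deriv f x + (x : ℂ) ^ 2 * deriv (deriv f) x) x :=
    (((hasDerivAt_id x).ofReal_comp).pow 2).mul hf.hasDerivAt
  rw [h.deriv, kahaneOp]
  push_cast
  ring

/-- **First vanishing condition (4.7)**: `Δ f(0) = 0`. [cite: ConnesConsani2021ScalingHamiltonian, §4.1 eqs. (4.7)–(4.8) (p0010:L2–L10)] -/
@[simp] theorem kahaneOp_apply_zero (f : ℝ → ℂ) : kahaneOp f 0 = 0 := by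
  simp [kahaneOp]

/-- **Second vanishing condition (4.7), `f̂(0) = ∫ Δf = 0`**, in the integration-by-parts form: if `f′` is
differentiable, `Δ f` is integrable and `x² f′(x) → 0` at `±∞` (all true for `f ∈ 𝒮(ℝ)`), then `∫ Δ f = 0`.
[cite: ConnesConsani2021ScalingHamiltonian, §4.1 eqs. (4.7)–(4.8) (p0010:L2–L10)] -/
theorem integral_kahaneOp_eq_zero {f : ℝ → ℂ} (hf : ∀ x, DifferentiableAt ℝ (deriv f) x)
    (hint : Integrable (kahaneOp f))
    (hbot : Tendsto (fun x : ℝ ↦ (x : ℂ) ^ 2 * deriv f x) atBot (𝓝 0))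
    (htop : Tendsto (fun x : ℝ ↦ (x : ℂ) ^ 2 * deriv f x) atTop (𝓝 0)) :
    ∫ x : ℝ, kahaneOp f x = 0 := by
  have hderiv : ∀ x, HasDerivAt (fun y : ℝ ↦ (y : ℂ) ^ 2 * deriv f y) (kahaneOp f x) x := by
    intro x
    have h : HasDerivAt (fun y : ℝ ↦ (y : ℂ) ^ 2 * deriv f y)
        ((2 : ℕ) * (x : ℂ) ^ (2 - 1) * 1 * deriv f x + (x : ℂ) ^ 2 * deriv (deriv f) x) x :=
      (((hasDerivAt_id x).ofReal_comp).pow 2).mul (hf x).hasDerivAt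
    convert h using 1
    rw [kahaneOp]; push_cast; ring
  rw [integral_of_hasDerivAt_of_tendsto hderiv hint hbot htop, sub_zero]

end Poisson

/-! ## §4.2 Time versus energy: the zeros of `L(q^{−s})` are `2πi/log q`-periodic -/

section TimeEnergy

/-- **§4.2**: for a curve over `𝔽_q` the zeta function is `L(q^{−s})`, so its zeros are invariant under
`s ↦ s + 2πi/log q` — "`Im(s) = (α_j + 2πk)/log q`": `q^{−(s + 2πi/log q)} = q^{−s}`.
[cite: ConnesConsani2021ScalingHamiltonian, §4.2 (p0010:L17–L21)] -/
theorem cpow_neg_add_period {q : ℕ} (hq : 1 < q) (s : ℂ) :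
    (q : ℂ) ^ (-(s + 2 * π * I / Real.log q)) = (q : ℂ) ^ (-s) := by
  have hq0 : (q : ℂ) ≠ 0 := by exact_mod_cast (show q ≠ 0 by omega)
  have hlog : (Real.log q : ℂ) ≠ 0 := by
    exact_mod_cast (Real.log_pos (by exact_mod_cast hq : (1 : ℝ) < q)).ne'
  have hlogq : Complex.log (q : ℂ) = (Real.log q : ℂ) := by
    rw [show (q : ℂ) = ((q : ℝ) : ℂ) by simp, Complex.ofReal_log (Nat.cast_nonneg q)]
  rw [Complex.cpow_def_of_ne_zero hq0, Complex.cpow_def_of_ne_zero hq0, hlogq]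
  refine Complex.exp_eq_exp_iff_exists_int.2 ⟨-1, ?_⟩
  rw [Int.cast_neg, Int.cast_one]
  field_simp
  ring

end TimeEnergy

/-! ## §4.1 (appended): Kahane's `Δ` commutes with the Fourier transform `𝔽_{e_ℝ}` on `𝒮(ℝ)` -/

section KahaneFourier

open SchwartzMap LineDeriv

/-- Multiplication by the coordinate `x` on `𝒮(ℝ, ℂ)` (Mathlib's `smulLeftCLM` with the temperate
function `x = ⟨x, 1⟩_ℝ`), the `Q` of the "`H = PQ`" discussion of §1 acting on Schwartz functions.
[cite: ConnesConsani2021ScalingHamiltonian, §1 ¶2 (p0004:L6) and §4.1 (p0010:L6)] -/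
def schwartzMulX : SchwartzMap ℝ ℂ →L[ℝ] SchwartzMap ℝ ℂ :=
  SchwartzMap.smulLeftCLM ℂ (inner ℝ · (1 : ℝ))

/-- `⟨·, 1⟩_ℝ` has temperate growth (private plumbing). [folklore] -/
private theorem inner_one_hasTemperateGrowth : (inner ℝ · (1 : ℝ) : ℝ → ℝ).HasTemperateGrowth := by
  fun_prop

/-- `(x • f)(x) = x f(x)`. [cite: ConnesConsani2021ScalingHamiltonian, §4.1 (p0010:L6)] -/
theorem schwartzMulX_apply (f : SchwartzMap ℝ ℂ) (x : ℝ) : schwartzMulX f x = (x : ℂ) * f x := by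
  rw [schwartzMulX, smulLeftCLM_apply_apply inner_one_hasTemperateGrowth]
  simp [Complex.real_smul]

/-- `∂_{1} f = f′` on `𝒮(ℝ, ℂ)` (private plumbing). [folklore] -/
private theorem lineDerivOp_one_apply (f : SchwartzMap ℝ ℂ) (x : ℝ) : (∂_{(1 : ℝ)} f) x = deriv f x := by
  rw [lineDerivOp_apply_eq_fderiv, fderiv_apply_one_eq_deriv]

/-- **The scaling Hamiltonian `D_u f = x f′` as an operator on `𝒮(ℝ, ℂ)`** (the Schwartz-space version
of `scalingDerivation`). [cite: ConnesConsani2021ScalingHamiltonian, §4.1 before eq. (4.8) (p0010:L6)] -/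
def scalingDerivationS (f : SchwartzMap ℝ ℂ) : SchwartzMap ℝ ℂ :=
  schwartzMulX (∂_{(1 : ℝ)} f)

/-- `D_u` on `𝒮(ℝ, ℂ)` is the pointwise `scalingDerivation`. [cite: ConnesConsani2021ScalingHamiltonian, §4.1 before eq. (4.8) (p0010:L6)] -/
theorem scalingDerivationS_apply (f : SchwartzMap ℝ ℂ) (x : ℝ) :
    scalingDerivationS f x = scalingDerivation f x := by
  rw [scalingDerivationS, schwartzMulX_apply, lineDerivOp_one_apply, scalingDerivation]

/-- Leibniz rule `(x h)′ = h + x h′` on `𝒮(ℝ, ℂ)`. [cite: ConnesConsani2021ScalingHamiltonian, §4.1 (the computation D_u² + D_u = x²∂² + 2x∂, p0010:L6–L9)] -/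
theorem lineDerivOp_schwartzMulX (h : SchwartzMap ℝ ℂ) :
    ∂_{(1 : ℝ)} (schwartzMulX h) = h + schwartzMulX (∂_{(1 : ℝ)} h) := by
  ext x
  rw [lineDerivOp_one_apply]
  change _ = h x + schwartzMulX (∂_{(1 : ℝ)} h) x
  rw [schwartzMulX_apply, lineDerivOp_one_apply]
  have hcoe : ⇑(schwartzMulX h) = fun y : ℝ ↦ (y : ℂ) * h y := funext (schwartzMulX_apply h)
  rw [hcoe]
  have hd : HasDerivAt (fun y : ℝ ↦ (y : ℂ) * h y) (1 * h x + (x : ℂ) * deriv h x) x :=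
    ((hasDerivAt_id x).ofReal_comp).mul (h.hasDerivAt x)
  rw [hd.deriv, one_mul]

/-- `D_u` is additive (private plumbing). [folklore] -/
private theorem scalingDerivationS_add (f g : SchwartzMap ℝ ℂ) :
    scalingDerivationS (f + g) = scalingDerivationS f + scalingDerivationS g := by
  simp [scalingDerivationS, lineDerivOp_add]

/-- `D_u (−f) = −D_u f` (private plumbing). [folklore] -/
private theorem scalingDerivationS_neg (f : SchwartzMap ℝ ℂ) :
    scalingDerivationS (-f) = -scalingDerivationS f := by
  simp [scalingDerivationS]

/-- **`𝔽 D_u = −(1 + D_u) 𝔽` on `𝒮(ℝ, ℂ)`**: the Fourier transform `𝔽_{e_ℝ}` (Mathlib's `𝓕`,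
character `e^{−2πixy}` of eq. (2.4)) intertwines the scaling Hamiltonian with minus its adjoint,
`𝓕 (x f′) = −𝓕 f − x (𝓕 f)′` — the infinitesimal form of "`I ∘ 𝔽_{e_ℝ}` commutes with scaling" (§4.1,
p0009:L53).  From Mathlib's `𝓕(f′) = 2πi x 𝓕f` and `(𝓕 f)′ = 𝓕(−2πi x f)`.
[cite: ConnesConsani2021ScalingHamiltonian, §4.1 (p0009:L49–L53, p0010:L6)] -/
theorem fourier_scalingDerivationS (f : SchwartzMap ℝ ℂ) :
    𝓕 (scalingDerivationS f) = -𝓕 f - scalingDerivationS (𝓕 f) := by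
  have hc : (2 * π * Complex.I) ≠ 0 := by
    simp [Real.pi_ne_zero, Complex.I_ne_zero]
  have key : ∀ g : SchwartzMap ℝ ℂ, 𝓕 (schwartzMulX g) = (-(2 * π * Complex.I))⁻¹ • ∂_{(1 : ℝ)} (𝓕 g) := by
    intro g
    have h := lineDerivOp_fourier_eq g (1 : ℝ)
    rw [FourierTransform.fourier_smul] at h
    rw [h, smul_smul, inv_mul_cancel₀ (neg_ne_zero.2 hc), one_smul]
    rfl
  have key2 : 𝓕 (∂_{(1 : ℝ)} f) = (2 * π * Complex.I) • schwartzMulX (𝓕 f) :=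
    fourier_lineDerivOp_eq f 1
  have hconst : (-(2 * π * Complex.I))⁻¹ * (2 * π * Complex.I) = -1 := by
    field_simp
  rw [scalingDerivationS, key, key2, lineDerivOp_smul, smul_smul, lineDerivOp_schwartzMulX, hconst,
    neg_one_smul, neg_add, scalingDerivationS]
  abel

/-- **Kahane's `Δ = D_u² + D_u` as an operator on `𝒮(ℝ, ℂ)`** (pointwise it is `kahaneOp`, see
`kahaneOpS_apply`). [cite: ConnesConsani2021ScalingHamiltonian, §4.1 eq. (4.8) (p0010:L6–L9)] -/
def kahaneOpS (f : SchwartzMap ℝ ℂ) : SchwartzMap ℝ ℂ :=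
  scalingDerivationS (scalingDerivationS f) + scalingDerivationS f

/-- `Δ` on `𝒮(ℝ, ℂ)` is the pointwise `Δ f = x² f″ + 2x f′`. [cite: ConnesConsani2021ScalingHamiltonian, §4.1 eq. (4.8) (p0010:L6–L9)] -/
theorem kahaneOpS_apply (f : SchwartzMap ℝ ℂ) (x : ℝ) : kahaneOpS f x = kahaneOp f x := by
  have hcoe : ⇑(scalingDerivationS f) = scalingDerivation f := funext (scalingDerivationS_apply f)
  have hderiv : deriv (⇑f) = ⇑(SchwartzMap.derivCLM ℝ ℂ f) :=
    funext fun y ↦ (SchwartzMap.derivCLM_apply (𝕜 := ℝ) f y).symm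
  have hf : DifferentiableAt ℝ (deriv ⇑f) x := by
    rw [hderiv]; exact (SchwartzMap.derivCLM ℝ ℂ f).differentiableAt
  change scalingDerivationS (scalingDerivationS f) x + scalingDerivationS f x = kahaneOp f x
  rw [scalingDerivationS_apply, scalingDerivationS_apply, hcoe, kahaneOp_eq_scalingDerivation hf]

/-- **"`Δ = D_u² + D_u` … commutes with Fourier transform"** (§4.1, p0010:L6): on `𝒮(ℝ, ℂ)`,
`𝓕 (Δ f) = Δ (𝓕 f)` for `𝓕 = 𝔽_{e_ℝ}`.  Proof: `𝓕 D_u = −(1 + D_u)𝓕`, hence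
`𝓕 (D_u² + D_u) = ((1 + D_u)² − (1 + D_u)) 𝓕 = (D_u² + D_u) 𝓕`.
[cite: ConnesConsani2021ScalingHamiltonian, §4.1 before eq. (4.8) (p0010:L6)] -/
theorem fourier_kahaneOpS (f : SchwartzMap ℝ ℂ) : 𝓕 (kahaneOpS f) = kahaneOpS (𝓕 f) := by
  rw [kahaneOpS, FourierTransform.fourier_add, fourier_scalingDerivationS, fourier_scalingDerivationS,
    kahaneOpS]
  have : scalingDerivationS (-𝓕 f - scalingDerivationS (𝓕 f)) =
      -scalingDerivationS (𝓕 f) - scalingDerivationS (scalingDerivationS (𝓕 f)) := by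
    rw [sub_eq_add_neg, scalingDerivationS_add, scalingDerivationS_neg, scalingDerivationS_neg,
      ← sub_eq_add_neg]
  rw [this]
  abel

/-- The same statement for the pointwise operator `kahaneOp` of eq. (4.8) on (coerced) Schwartz functions:
`𝓕 (x² f″ + 2x f′) = x² (𝓕f)″ + 2x (𝓕f)′`. [cite: ConnesConsani2021ScalingHamiltonian, §4.1 eqs. (4.7)–(4.8) (p0010:L6–L10)] -/
theorem fourier_kahaneOp (f : SchwartzMap ℝ ℂ) :
    𝓕 (kahaneOp (f : ℝ → ℂ)) = kahaneOp (𝓕 (f : ℝ → ℂ)) := by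
  have h1 : kahaneOp (f : ℝ → ℂ) = ⇑(kahaneOpS f) := funext fun x ↦ (kahaneOpS_apply f x).symm
  have h2 : kahaneOp (𝓕 (f : ℝ → ℂ)) = ⇑(kahaneOpS (𝓕 f)) :=
    funext fun x ↦ (kahaneOpS_apply (𝓕 f) x).symm
  rw [h1, h2, ← SchwartzMap.fourier_coe, fourier_kahaneOpS]

end KahaneFourier

end ScalingHamiltonian

end Literature.NumberTheory.ConnesConsani2021
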